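import Literature.NumberTheory.Rogawski1990.TamagawaSingularKappaPinning   -- ★ p848504 (LH5-p02): `isHaarMeasure_and_isInvInvariant_partner` (HAAR of any (Q-fin)+(COH-fin) system); brings the letter ★ p844690, ★ `TamagawaSingularFinPartners` (`singularGuard_conj`, `forall_mul_toLocal_eq_of_coe_eq_smul_one`, `not_isRegularElt_and_corresponds_self`), ★ `quotientMeasure_eq_inv_smul_of_eq_smul`, ★ `isInvInvariant_nnreal_smul`
import Literature.NumberTheory.Rogawski1990.IsQuotientOfHaarRatio           -- ★ p847850: `stableOrbitalIntegralRel_congr_measure` (`Φ^st(γ, ·)` reads the members on the stable class of `γ` only)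
import HarnessLib

/-!
# [Rogawski1990 §8.2 Prop. 8.2.1 (a), (b) p. 118; §14.5 L. 14.5.2 (b) pp. 238–239] S1′-fin-TF-COVOL — THE «O1-DEDUP CERTIFICATE»: «O1 ⟸ O4♮ ∧ ARCH-κ-SIGN∀»
# (LH5 pay-down of `stub_S1finTFCovol`, leaf `Cruxes/H413/Lines/F0_P3c_S1finTFCovolPaydown.lean` ED. 3 → ED. 4 «O1♮»)

Topic `NumberTheory/Rogawski1990`; namespace `Literature.NumberTheory.Rogawski1990`.  THEOREMS ONLY (no definition, no named fact, no instance, no notation, no `sorry`).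
Cell `pub/hodgecm-mathlib`, crux H413 = stmt-HodgeConjecture-24833; GO-500 half A line **LH5**, LH5-p05 (g3), dealt by LH5-plan (g2) 2026-09-02T07:42Z (item (γ) of the census
`F0/P3c/LH5/LH5-p01/g2/CENSUS-O4nat-depth.LH5-p01g2.md` §4, banked by LH5-plan (g0)'s ruling 07:33Z).  ★ p844690's `section Frame` binders VERBATIM; the organ texts O1 (:149–:241)
and O4♮ (:254–:357) are generator-sliced from the TREE leaf ED. 3 (076dfd43c911e418) token for token (pattern of ★ `TamagawaSingularCovolEqCertificate` p848619 ∕ ★ `…OfPin` p848810).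
HONEST LABEL: HC_CM is proved only modulo the printed citations until rung 0 closes; this file proves NO printed citation — it is the bookkeeping that lets the leaf book the
finite (κ-loc) existence ONCE: after it, ED. 4's print organs are {O4♮ «T′-κ-SYSTEM», ARCH-κ-SIGN∀} and O1 «κ-SYSTEM» is DERIVED in-leaf (count-neutral reshuffle, floor 2 → 2).

WHAT.  The leaf's print organ O1 `stub_finPartners_kappaSystem` («κ-SYSTEM»: local centraliser partners `tGs` with (HAAR) (COH-fin) (LEV) (CEN) and ONE Weil-quotient family `mGs₀` of
`νG_v` by `tGs v` ((Q-fin)) carrying the κ-BLOCK-TF (κ-loc) ∧ (κ-arch) ∧ (κ-sign)) follows from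
* `href` = O4♮ `stub_tprimeKappaSystem` VERBATIM — print's ONE witness `(mGs₀, tGs₀)` with (Q-fin)₀ ∧ (COH-fin)₀ ∧ (LEV)₀ ∧ (κ-loc-Q)₀ ∧ (T′)₀ ((T′)₀ is not read here), and
* `hAKS` = **ARCH-κ-SIGN∀** — for EVERY (Q-fin)+(COH-fin)+(LEV) system `(mGs₀, tGs₀)` and every κ-block datum `(γ₀, e₁, e₂, γH)` (binders VERBATIM): the finite (κ-loc) letters ALONE
  (`∃ c, (∀ v, c v ≠ 0) ∧ (κ-loc)[mGs₀, c]`) imply the full κ-BLOCK-TF `∃ c cinf, … (κ-loc) ∧ (κ-arch) ∧ (κ-sign)` (the organ may re-pick `c`).  Print: the archimedean letter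
  (κ-arch) is Prop. 8.2.1 (a) at the real place ∕ L. 14.5.2 (b) with the (8.3.1)-measure, and (κ-sign) («`cinf · ∏_{v ∈ S} c_v` is a positive real on every co-unit set `S`») is
  Prop. 8.2.1 (b) (the product formula `∏_v Δ_{G_v∕H_v}(γ₀) = 1` on `M`) once the finite `c_v` are the PINNED ones (★ p848504: (κ-loc) determines `c_v` classwise up to the
  positive level-mass ratios).  ARCH-κ-SIGN∀ reads NO finite measure beyond the (κ-loc) letters it is handed.

THE MATHEMATICS (all tools ★).  O4♮'s partners `tGs₀` already have (HAAR) at every guard point (★ `isHaarMeasure_and_isInvInvariant_partner`: (Q-fin)₀ at the representative, (COH-fin)₀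
along the conjugation), (COH-fin), (LEV); they lack only (CEN) = level mass ONE at the local images `(ζ•1)_v` of the rational scalars at EVERY place ((LEV)₀ gives it off a finite
set).  CENTRAL REPAIR: rescale print's own partners there — `tGs v x := a_v(x) • tGs₀ v x` with `a_v(x) := (tGs₀ v x (Z(x) ∩ K_v))⁻¹` if `x` is the local image of a rational scalar
and `a_v(x) := 1` otherwise; the members follow Weil's rule `dν ∕ d(a·t) = a⁻¹ · dν ∕ dt` (★ `quotientMeasure_eq_inv_smul_of_eq_smul`): `mGs v c := a_v(out c)⁻¹ • mGs₀ v c`.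
(CEN): `(ζ•1)_v` is a guard point (★ `not_isRegularElt_of_coe_eq_smul_one`, `↔` reflexive), so `tGs₀ v (ζ•1)_v` is a Haar measure and the compact open `Z ∩ K_v ∋ 1` has mass in
`(0, ∞)`.  (LEV): wherever (LEV)₀ already gives mass `1`, `a_v = 1`.  (COH-fin): a rational-scalar image is CENTRAL in `G_v` (★ `forall_mul_toLocal_eq_of_coe_eq_smul_one`), so
`q x q⁻¹ = x` and the rescaling predicate is conjugation-stable; off it, (COH-fin)₀.  (HAAR): positive multiples of Haar ∕ inversion-invariant measures (Mathlib
`IsHaarMeasure.nnreal_smul`, ★ `isInvInvariant_nnreal_smul`).  κ-BLOCK-TF: ARCH-κ-SIGN∀ applied to print's system `(mGs₀, tGs₀)` and its (κ-loc-Q)₀; then TRANSPORT to `mGs` (pattern of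
★ O6 `kappaBlockTF_of_isQuotientOf_of_isQuotientOf`, p848260): (κ-loc) reads `mGs v` only on the classes `[x]` with `(γ₀)_v ↔ x`, i.e. `GL₃(L ⊗ L⁺_v)`-conjugate to `(γ₀)_v`
(★ `stableOrbitalIntegralRel_congr_measure`); were such an `x` the image of a rational scalar `ζ•1`, it would be central in `GL₃`, so `(γ₀)_v = x` and — the entrywise
localisation `M₃(L) → M₃(L ⊗ L⁺_v)` being injective (★ `coe_toLocal_toAdelic_eq_map`) — `γ₀ = ζ•1`, excluded by the κ-block's binder `¬ ∃ ζ, γ₀ = ζ•1`; hence `a_v = 1` on every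
class the letters read, and (κ-arch) ∕ (κ-sign) do not read the finite members at all.

* §1 helpers (finite place `v` of `L⁺`, `G_v = U(H′)(L⁺_v)` on the `cmDatum` carrier): `coe_eq_smul_one_of_corresponds_toLocal_of_coe_eq_smul_one` (a rational `γ₀` whose local
  image corresponds to the local image of a rational scalar IS that scalar), `eq_of_conj_eq_toLocal_of_coe_eq_smul_one` (conjugates of a rational-scalar image are the point itself),
  `measure_preimage_level_pos_lt_top` (a Haar measure on a centraliser gives the trace `Z(x) ∩ K_v` of the compact open level group positive finite mass).
* §2 **`finPartners_kappaSystem_of_reference_of_archSign`** — THE CERTIFICATE `‹O4♮› → ‹ARCH-κ-SIGN∀› → ‹O1›` at the frame (organ texts VERBATIM).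

## References
* [Rogawski1990] J. D. Rogawski, *Automorphic Representations of Unitary Groups in Three Variables*, Ann. of Math. Stud. 123 (1990): §1.7 p. 6, p. 11 (compatible ∕ Tamagawa measures);
  §4.3 (4.3.1) pp. 43–44 (orbital integrals with compatible centraliser measures; the mass of `K`); §8.1 Props. 8.1.3, 8.1.4 pp. 116–118; §8.2 Prop. 8.2.1 (a), (b) p. 118 (the local
  letters `Φ^st = Δ·f^H` for singular `γ₀` and the product formula); §14.5 Lemma 14.5.2 (b) pp. 238–239 (the archimedean letter with the (8.3.1)-measure; «a special case of [Kt₆] Prop. 2»);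
  Prop. 10.1.2 (b) p. 153 (central terms).
* [Kottwitz1988] R. E. Kottwitz, *Tamagawa numbers*, Ann. of Math. 127 (1988), §1, Thm. 1, Prop. 2.
* [DeitmarEchterhoff2014] A. Deitmar, S. Echterhoff, *Principles of Harmonic Analysis*, 2nd ed. (2014), Thm. 1.5.3 (Weil's quotient measure and its scaling).
-/

set_option autoImplicit false

noncomputable section

open MeasureTheory Measure NumberField IsDedekindDomain
open Literature.MeasureTheory.Group Literature.MeasureTheory.RestrictedProduct
open Literature.Topology.RestrictedProduct Literature.Topology.Algebra.RestrictedProduct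
open scoped Matrix MatrixGroups RestrictedProduct NNReal ENNReal Topology

namespace Literature.NumberTheory.Rogawski1990

open Literature.NumberTheory.Automorphic
open Literature.AlgebraicGeometry.ShimuraVarieties (unitaryGroup hermForm)

/-! ## §1 Helpers at a finite place `v` of `L⁺`: rational-scalar images in `G_v = U(H′)(L⁺_v)` and the mass of the level group on a centraliser -/

section Place

variable (L : Type) [Field L] [NumberField L] [IsCMField L] (H' : Matrix (Fin 3) (Fin 3) L)
  (v : HeightOneSpectrum (𝓞 ↥(maximalRealSubfield L)))

/-- The matrix of the local image `(ζ•1)_v` of a rational scalar `ζ•1 ∈ U(H′)(L⁺)` is the scalar `(ζ ⊗ 1)•1` (★ `coe_toLocal_toAdelic_eq_map`; the two lines of ★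
`forall_mul_toLocal_eq_of_coe_eq_smul_one`). [cite: Rogawski1990, §3.1 p. 19] -/
theorem coe_toLocal_toAdelic_eq_smul_one_of_coe_eq_smul_one (γ₁ : (UnitaryGroup.cmDatum L 3 H').Rational) {ζ : L}
    (hζ : (((γ₁.val : GL (Fin 3) L)) : Matrix (Fin 3) (Fin 3) L) = ζ • (1 : Matrix (Fin 3) (Fin 3) L)) :
    ((((UnitaryGroup.cmDatum L 3 H').toLocal v ((UnitaryGroup.cmDatum L 3 H').toAdelic γ₁)).val : GL (Fin 3) (UnitaryGroup.LocalRing L v)).val :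
        Matrix (Fin 3) (Fin 3) (UnitaryGroup.LocalRing L v)) =
      algebraMap L (UnitaryGroup.LocalRing L v) ζ • (1 : Matrix (Fin 3) (Fin 3) (UnitaryGroup.LocalRing L v)) := by
  rw [coe_toLocal_toAdelic_eq_map, hζ, Matrix.map_smul' _ _ _ (map_mul _), Matrix.map_one _ (map_zero _) (map_one _)]

/-- **A rational `γ₀` whose local image is stably conjugate (`GL₃(L ⊗ L⁺_v)`-conjugate, ★ `IsStablyConj` = the local `↔`) to the local image of a rational SCALAR `ζ•1` IS `ζ•1`**:
the scalar `(ζ•1)_v` is central in `GL₃`, so the two local images coincide, and the entrywise localisation `M₃(L) → M₃(L ⊗ L⁺_v)` is injective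
(★ `coe_toLocal_toAdelic_eq_map`, Mathlib `Matrix.map_injective`). [cite: Rogawski1990, §3.1 p. 19; §14.1 p. 232] -/
theorem coe_eq_smul_one_of_isStablyConj_toLocal_of_coe_eq_smul_one (γ₀ γ₁ : (UnitaryGroup.cmDatum L 3 H').Rational) {ζ : L}
    (hζ : (((γ₁.val : GL (Fin 3) L)) : Matrix (Fin 3) (Fin 3) L) = ζ • (1 : Matrix (Fin 3) (Fin 3) L))
    {x : (UnitaryGroup.cmDatum L 3 H').Local v}
    (hx : IsStablyConj (UnitaryGroup.conjLocal L (IsCMField.complexConj L) v) ((UnitaryGroup.adelicForm L 3 H').map (UnitaryGroup.adeleToLocal L v))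
      ((UnitaryGroup.cmDatum L 3 H').toLocal v ((UnitaryGroup.cmDatum L 3 H').toAdelic γ₀)) x)
    (hx₁ : x = (UnitaryGroup.cmDatum L 3 H').toLocal v ((UnitaryGroup.cmDatum L 3 H').toAdelic γ₁)) :
    (((γ₀.val : GL (Fin 3) L)) : Matrix (Fin 3) (Fin 3) L) = ζ • (1 : Matrix (Fin 3) (Fin 3) L) := by
  subst hx₁
  obtain ⟨g, hg⟩ := isStablyConj_iff.1 hx
  have hb := coe_toLocal_toAdelic_eq_smul_one_of_coe_eq_smul_one L H' v γ₁ hζ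
  -- `(γ₀)_v = g⁻¹ (ζ•1)_v g = (ζ•1)_v` in `GL₃(L ⊗ L⁺_v)`
  have ha : ((((UnitaryGroup.cmDatum L 3 H').toLocal v ((UnitaryGroup.cmDatum L 3 H').toAdelic γ₀)).val : GL (Fin 3) (UnitaryGroup.LocalRing L v))) =
      g⁻¹ * (((UnitaryGroup.cmDatum L 3 H').toLocal v ((UnitaryGroup.cmDatum L 3 H').toAdelic γ₁)).val : GL (Fin 3) (UnitaryGroup.LocalRing L v)) * g := by
    rw [← hg]; group
  have hmat := congrArg (fun u : GL (Fin 3) (UnitaryGroup.LocalRing L v) => u.val) ha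
  simp only [Units.val_mul] at hmat
  rw [hb, Matrix.mul_smul, Matrix.mul_one, Matrix.smul_mul, ← Units.val_mul, inv_mul_cancel, Units.val_one, coe_toLocal_toAdelic_eq_map] at hmat
  -- injectivity of the entrywise localisation
  refine Matrix.map_injective (algebraMap L (UnitaryGroup.LocalRing L v)).injective ?_
  change ((((γ₀.val : GL (Fin 3) L)) : Matrix (Fin 3) (Fin 3) L)).map (algebraMap L (UnitaryGroup.LocalRing L v)) =
    (ζ • (1 : Matrix (Fin 3) (Fin 3) L)).map (algebraMap L (UnitaryGroup.LocalRing L v))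
  rw [hmat, Matrix.map_smul' _ _ _ (map_mul _), Matrix.map_one _ (map_zero _) (map_one _)]

/-- **A rational-scalar image is central in `U(H′)(L⁺_v)`**: `q (ζ•1)_v q⁻¹ = (ζ•1)_v` (★ `forall_mul_toLocal_eq_of_coe_eq_smul_one`). [cite: Rogawski1990, §3.1 p. 19] -/
theorem conj_toLocal_eq_of_coe_eq_smul_one (γ₁ : (UnitaryGroup.cmDatum L 3 H').Rational) {ζ : L}
    (hζ : (((γ₁.val : GL (Fin 3) L)) : Matrix (Fin 3) (Fin 3) L) = ζ • (1 : Matrix (Fin 3) (Fin 3) L)) (q : (UnitaryGroup.cmDatum L 3 H').Local v) :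
    q * (UnitaryGroup.cmDatum L 3 H').toLocal v ((UnitaryGroup.cmDatum L 3 H').toAdelic γ₁) * q⁻¹ =
      (UnitaryGroup.cmDatum L 3 H').toLocal v ((UnitaryGroup.cmDatum L 3 H').toAdelic γ₁) := by
  rw [forall_mul_toLocal_eq_of_coe_eq_smul_one L H' v γ₁ hζ q, mul_inv_cancel_right]

/-- **The conjugacy class of a rational-scalar image is the point itself**: `q y q⁻¹ = (ζ•1)_v ⇒ y = (ζ•1)_v`. [cite: Rogawski1990, §3.1 p. 19] -/
theorem eq_toLocal_of_conj_eq_toLocal_of_coe_eq_smul_one (γ₁ : (UnitaryGroup.cmDatum L 3 H').Rational) {ζ : L}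
    (hζ : (((γ₁.val : GL (Fin 3) L)) : Matrix (Fin 3) (Fin 3) L) = ζ • (1 : Matrix (Fin 3) (Fin 3) L)) (y q : (UnitaryGroup.cmDatum L 3 H').Local v)
    (hq : q * y * q⁻¹ = (UnitaryGroup.cmDatum L 3 H').toLocal v ((UnitaryGroup.cmDatum L 3 H').toAdelic γ₁)) :
    y = (UnitaryGroup.cmDatum L 3 H').toLocal v ((UnitaryGroup.cmDatum L 3 H').toAdelic γ₁) := by
  have h := conj_toLocal_eq_of_coe_eq_smul_one L H' v γ₁ hζ q⁻¹
  rw [← hq, inv_inv] at h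
  -- `h : q⁻¹ * (q * y * q⁻¹) * q = q * y * q⁻¹`
  calc y = q⁻¹ * (q * y * q⁻¹) * q := by group
    _ = q * y * q⁻¹ := h
    _ = _ := hq

/-- **`0 < t(Z(x) ∩ K_v) < ∞`** for a Haar measure `t` on the centraliser `Z(x)`: the level group `K_v` is compact open (★ `isCompact_isOpen_cmLocalIntegralLevel`) and contains `1`,
and `Z(x)` is closed. [cite: Rogawski1990, §4.3 p. 44] -/
theorem measure_preimage_level_pos_lt_top [MeasurableSpace ((UnitaryGroup.cmDatum L 3 H').Local v)] [BorelSpace ((UnitaryGroup.cmDatum L 3 H').Local v)]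
    (x : (UnitaryGroup.cmDatum L 3 H').Local v)
    (t : Measure ↥(Subgroup.centralizer ({x} : Set ((UnitaryGroup.cmDatum L 3 H').Local v)))) [t.IsHaarMeasure] :
    0 < t (Subtype.val ⁻¹' (UnitaryGroup.cmLocalIntegralLevel L 3 H' v : Set ((UnitaryGroup.cmDatum L 3 H').Local v))) ∧
      t (Subtype.val ⁻¹' (UnitaryGroup.cmLocalIntegralLevel L 3 H' v : Set ((UnitaryGroup.cmDatum L 3 H').Local v))) < ∞ := by
  obtain ⟨hKc, hKo⟩ := UnitaryGroup.isCompact_isOpen_cmLocalIntegralLevel L 3 H' v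
  refine ⟨(hKo.preimage continuous_subtype_val).measure_pos t ⟨1, ?_⟩, ?_⟩
  · exact (UnitaryGroup.cmLocalIntegralLevel L 3 H' v).one_mem
  · exact ((isClosed_coe_centralizer_singleton x).isClosedEmbedding_subtypeVal.isCompact_preimage hKc).measure_lt_top

end Place

section Frame

variable (L : Type) [Field L] [NumberField L] [IsCMField L]

variable (H' : Matrix (Fin 3) (Fin 3) L) (Tinf : ArchTransferFactor L H')
    -- σ-algebras of the `G′` side (★ (O10-c5) block), of `H_v`, `G_∞`, `H_∞`, and the Haar data — EXACTLY ★ `SingularEllipticTransfer`'s binders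
    [∀ g : (UnitaryGroup.cmDatum L 3 H').Adelic, MeasurableSpace ((UnitaryGroup.cmDatum L 3 H').Adelic ⧸ Subgroup.centralizer ({g} : Set (UnitaryGroup.cmDatum L 3 H').Adelic))]
    [∀ g : (UnitaryGroup.cmDatum L 3 H').Adelic, BorelSpace ((UnitaryGroup.cmDatum L 3 H').Adelic ⧸ Subgroup.centralizer ({g} : Set (UnitaryGroup.cmDatum L 3 H').Adelic))]
    [∀ γ : UnitaryGroup.arch (↥(maximalRealSubfield L)) L (IsCMField.complexConj L) 3 H',
      MeasurableSpace (UnitaryGroup.arch (↥(maximalRealSubfield L)) L (IsCMField.complexConj L) 3 H' ⧸ Subgroup.centralizer ({γ} : Set (UnitaryGroup.arch (↥(maximalRealSubfield L)) L (IsCMField.complexConj L) 3 H')))]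
    [∀ γ : UnitaryGroup.arch (↥(maximalRealSubfield L)) L (IsCMField.complexConj L) 3 H',
      BorelSpace (UnitaryGroup.arch (↥(maximalRealSubfield L)) L (IsCMField.complexConj L) 3 H' ⧸ Subgroup.centralizer ({γ} : Set (UnitaryGroup.arch (↥(maximalRealSubfield L)) L (IsCMField.complexConj L) 3 H')))]
    [∀ (v : HeightOneSpectrum (𝓞 ↥(maximalRealSubfield L))) (γ : (UnitaryGroup.cmDatum L 3 H').Local v),
      MeasurableSpace ((UnitaryGroup.cmDatum L 3 H').Local v ⧸ Subgroup.centralizer ({γ} : Set ((UnitaryGroup.cmDatum L 3 H').Local v)))]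
    [∀ (v : HeightOneSpectrum (𝓞 ↥(maximalRealSubfield L))) (γ : (UnitaryGroup.cmDatum L 3 H').Local v),
      BorelSpace ((UnitaryGroup.cmDatum L 3 H').Local v ⧸ Subgroup.centralizer ({γ} : Set ((UnitaryGroup.cmDatum L 3 H').Local v)))]
    [∀ v : HeightOneSpectrum (𝓞 ↥(maximalRealSubfield L)), MeasurableSpace ((UnitaryGroup.cmDatum L 3 H').Local v)] [∀ v : HeightOneSpectrum (𝓞 ↥(maximalRealSubfield L)), BorelSpace ((UnitaryGroup.cmDatum L 3 H').Local v)]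
    [MeasurableSpace (UnitaryGroup.cmDatum L 3 H').Adelic] [BorelSpace (UnitaryGroup.cmDatum L 3 H').Adelic]
    [MeasurableSpace (UnitaryGroup.arch (↥(maximalRealSubfield L)) L (IsCMField.complexConj L) 3 H')] [BorelSpace (UnitaryGroup.arch (↥(maximalRealSubfield L)) L (IsCMField.complexConj L) 3 H')]
    [∀ γ : (UnitaryGroup.cmDatum L 3 H').Adelic, MeasurableSpace (↥(Subgroup.centralizer ({γ} : Set (UnitaryGroup.cmDatum L 3 H').Adelic)) ⧸
      ((UnitaryGroup.cmDatum L 3 H').quotientSubgroup ⊓ Subgroup.centralizer ({γ} : Set (UnitaryGroup.cmDatum L 3 H').Adelic)).subgroupOf (Subgroup.centralizer ({γ} : Set (UnitaryGroup.cmDatum L 3 H').Adelic)))]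
    [∀ γ : (UnitaryGroup.cmDatum L 3 H').Adelic, BorelSpace (↥(Subgroup.centralizer ({γ} : Set (UnitaryGroup.cmDatum L 3 H').Adelic)) ⧸
      ((UnitaryGroup.cmDatum L 3 H').quotientSubgroup ⊓ Subgroup.centralizer ({γ} : Set (UnitaryGroup.cmDatum L 3 H').Adelic)).subgroupOf (Subgroup.centralizer ({γ} : Set (UnitaryGroup.cmDatum L 3 H').Adelic)))]
    [hCcl : ∀ γ : (UnitaryGroup.cmDatum L 3 H').Adelic, IsClosed ((Subgroup.centralizer ({γ} : Set (UnitaryGroup.cmDatum L 3 H').Adelic) : Subgroup (UnitaryGroup.cmDatum L 3 H').Adelic) : Set (UnitaryGroup.cmDatum L 3 H').Adelic)]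
    [∀ γ : (UnitaryGroup.cmDatum L 3 H').Adelic, (count : Measure ↥(((UnitaryGroup.cmDatum L 3 H').quotientSubgroup ⊓ Subgroup.centralizer ({γ} : Set (UnitaryGroup.cmDatum L 3 H').Adelic)).subgroupOf
      (Subgroup.centralizer ({γ} : Set (UnitaryGroup.cmDatum L 3 H').Adelic)))).IsHaarMeasure]
    [∀ v : HeightOneSpectrum (𝓞 ↥(maximalRealSubfield L)), MeasurableSpace ((UnitaryGroup.cmDatum L 2 (Matrix.of fun i j : Fin 2 => if i.val + j.val + 1 = 2 then (1 : L) else 0)).Local v ×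
        (UnitaryGroup.cmDatum L 1 (Matrix.of fun i j : Fin 1 => if i.val + j.val + 1 = 1 then (1 : L) else 0)).Local v)]
    [∀ v : HeightOneSpectrum (𝓞 ↥(maximalRealSubfield L)), BorelSpace ((UnitaryGroup.cmDatum L 2 (Matrix.of fun i j : Fin 2 => if i.val + j.val + 1 = 2 then (1 : L) else 0)).Local v ×
        (UnitaryGroup.cmDatum L 1 (Matrix.of fun i j : Fin 1 => if i.val + j.val + 1 = 1 then (1 : L) else 0)).Local v)]
    [∀ (v : HeightOneSpectrum (𝓞 ↥(maximalRealSubfield L))) (a : ((UnitaryGroup.cmDatum L 2 (Matrix.of fun i j : Fin 2 => if i.val + j.val + 1 = 2 then (1 : L) else 0)).Local v ×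
        (UnitaryGroup.cmDatum L 1 (Matrix.of fun i j : Fin 1 => if i.val + j.val + 1 = 1 then (1 : L) else 0)).Local v)),
      MeasurableSpace (((UnitaryGroup.cmDatum L 2 (Matrix.of fun i j : Fin 2 => if i.val + j.val + 1 = 2 then (1 : L) else 0)).Local v ×
        (UnitaryGroup.cmDatum L 1 (Matrix.of fun i j : Fin 1 => if i.val + j.val + 1 = 1 then (1 : L) else 0)).Local v) ⧸ Subgroup.centralizer ({a} : Set ((UnitaryGroup.cmDatum L 2 (Matrix.of fun i j : Fin 2 => if i.val + j.val + 1 = 2 then (1 : L) else 0)).Local v ×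
        (UnitaryGroup.cmDatum L 1 (Matrix.of fun i j : Fin 1 => if i.val + j.val + 1 = 1 then (1 : L) else 0)).Local v)))]
    [∀ (v : HeightOneSpectrum (𝓞 ↥(maximalRealSubfield L))) (a : ((UnitaryGroup.cmDatum L 2 (Matrix.of fun i j : Fin 2 => if i.val + j.val + 1 = 2 then (1 : L) else 0)).Local v ×
        (UnitaryGroup.cmDatum L 1 (Matrix.of fun i j : Fin 1 => if i.val + j.val + 1 = 1 then (1 : L) else 0)).Local v)),
      BorelSpace (((UnitaryGroup.cmDatum L 2 (Matrix.of fun i j : Fin 2 => if i.val + j.val + 1 = 2 then (1 : L) else 0)).Local v ×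
        (UnitaryGroup.cmDatum L 1 (Matrix.of fun i j : Fin 1 => if i.val + j.val + 1 = 1 then (1 : L) else 0)).Local v) ⧸ Subgroup.centralizer ({a} : Set ((UnitaryGroup.cmDatum L 2 (Matrix.of fun i j : Fin 2 => if i.val + j.val + 1 = 2 then (1 : L) else 0)).Local v ×
        (UnitaryGroup.cmDatum L 1 (Matrix.of fun i j : Fin 1 => if i.val + j.val + 1 = 1 then (1 : L) else 0)).Local v)))]
    [MeasurableSpace (UnitaryGroup.arch (↥(maximalRealSubfield L)) L (IsCMField.complexConj L) 3 (Matrix.of fun i j : Fin 3 => if i.val + j.val + 1 = 3 then (1 : L) else 0))] [BorelSpace (UnitaryGroup.arch (↥(maximalRealSubfield L)) L (IsCMField.complexConj L) 3 (Matrix.of fun i j : Fin 3 => if i.val + j.val + 1 = 3 then (1 : L) else 0))]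
    [∀ γ : UnitaryGroup.arch (↥(maximalRealSubfield L)) L (IsCMField.complexConj L) 3 (Matrix.of fun i j : Fin 3 => if i.val + j.val + 1 = 3 then (1 : L) else 0),
      MeasurableSpace (UnitaryGroup.arch (↥(maximalRealSubfield L)) L (IsCMField.complexConj L) 3 (Matrix.of fun i j : Fin 3 => if i.val + j.val + 1 = 3 then (1 : L) else 0) ⧸ Subgroup.centralizer ({γ} : Set (UnitaryGroup.arch (↥(maximalRealSubfield L)) L (IsCMField.complexConj L) 3 (Matrix.of fun i j : Fin 3 => if i.val + j.val + 1 = 3 then (1 : L) else 0))))]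
    [∀ γ : UnitaryGroup.arch (↥(maximalRealSubfield L)) L (IsCMField.complexConj L) 3 (Matrix.of fun i j : Fin 3 => if i.val + j.val + 1 = 3 then (1 : L) else 0),
      BorelSpace (UnitaryGroup.arch (↥(maximalRealSubfield L)) L (IsCMField.complexConj L) 3 (Matrix.of fun i j : Fin 3 => if i.val + j.val + 1 = 3 then (1 : L) else 0) ⧸ Subgroup.centralizer ({γ} : Set (UnitaryGroup.arch (↥(maximalRealSubfield L)) L (IsCMField.complexConj L) 3 (Matrix.of fun i j : Fin 3 => if i.val + j.val + 1 = 3 then (1 : L) else 0))))]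
    [MeasurableSpace (UnitaryGroup.arch (↥(maximalRealSubfield L)) L (IsCMField.complexConj L) 2 (Matrix.of fun i j : Fin 2 => if i.val + j.val + 1 = 2 then (1 : L) else 0) ×
          UnitaryGroup.arch (↥(maximalRealSubfield L)) L (IsCMField.complexConj L) 1 (Matrix.of fun i j : Fin 1 => if i.val + j.val + 1 = 1 then (1 : L) else 0))]
    [BorelSpace (UnitaryGroup.arch (↥(maximalRealSubfield L)) L (IsCMField.complexConj L) 2 (Matrix.of fun i j : Fin 2 => if i.val + j.val + 1 = 2 then (1 : L) else 0) ×
          UnitaryGroup.arch (↥(maximalRealSubfield L)) L (IsCMField.complexConj L) 1 (Matrix.of fun i j : Fin 1 => if i.val + j.val + 1 = 1 then (1 : L) else 0))]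
    [∀ a : (UnitaryGroup.arch (↥(maximalRealSubfield L)) L (IsCMField.complexConj L) 2 (Matrix.of fun i j : Fin 2 => if i.val + j.val + 1 = 2 then (1 : L) else 0) ×
          UnitaryGroup.arch (↥(maximalRealSubfield L)) L (IsCMField.complexConj L) 1 (Matrix.of fun i j : Fin 1 => if i.val + j.val + 1 = 1 then (1 : L) else 0)),
      MeasurableSpace ((UnitaryGroup.arch (↥(maximalRealSubfield L)) L (IsCMField.complexConj L) 2 (Matrix.of fun i j : Fin 2 => if i.val + j.val + 1 = 2 then (1 : L) else 0) ×
          UnitaryGroup.arch (↥(maximalRealSubfield L)) L (IsCMField.complexConj L) 1 (Matrix.of fun i j : Fin 1 => if i.val + j.val + 1 = 1 then (1 : L) else 0)) ⧸ Subgroup.centralizer ({a} : Set (UnitaryGroup.arch (↥(maximalRealSubfield L)) L (IsCMField.complexConj L) 2 (Matrix.of fun i j : Fin 2 => if i.val + j.val + 1 = 2 then (1 : L) else 0) ×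
          UnitaryGroup.arch (↥(maximalRealSubfield L)) L (IsCMField.complexConj L) 1 (Matrix.of fun i j : Fin 1 => if i.val + j.val + 1 = 1 then (1 : L) else 0))))]
    [∀ a : (UnitaryGroup.arch (↥(maximalRealSubfield L)) L (IsCMField.complexConj L) 2 (Matrix.of fun i j : Fin 2 => if i.val + j.val + 1 = 2 then (1 : L) else 0) ×
          UnitaryGroup.arch (↥(maximalRealSubfield L)) L (IsCMField.complexConj L) 1 (Matrix.of fun i j : Fin 1 => if i.val + j.val + 1 = 1 then (1 : L) else 0)),
      BorelSpace ((UnitaryGroup.arch (↥(maximalRealSubfield L)) L (IsCMField.complexConj L) 2 (Matrix.of fun i j : Fin 2 => if i.val + j.val + 1 = 2 then (1 : L) else 0) ×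
          UnitaryGroup.arch (↥(maximalRealSubfield L)) L (IsCMField.complexConj L) 1 (Matrix.of fun i j : Fin 1 => if i.val + j.val + 1 = 1 then (1 : L) else 0)) ⧸ Subgroup.centralizer ({a} : Set (UnitaryGroup.arch (↥(maximalRealSubfield L)) L (IsCMField.complexConj L) 2 (Matrix.of fun i j : Fin 2 => if i.val + j.val + 1 = 2 then (1 : L) else 0) ×
          UnitaryGroup.arch (↥(maximalRealSubfield L)) L (IsCMField.complexConj L) 1 (Matrix.of fun i j : Fin 1 => if i.val + j.val + 1 = 1 then (1 : L) else 0))))]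
    (νH : ∀ v : HeightOneSpectrum (𝓞 ↥(maximalRealSubfield L)), Measure ((UnitaryGroup.cmDatum L 2 (Matrix.of fun i j : Fin 2 => if i.val + j.val + 1 = 2 then (1 : L) else 0)).Local v ×
        (UnitaryGroup.cmDatum L 1 (Matrix.of fun i j : Fin 1 => if i.val + j.val + 1 = 1 then (1 : L) else 0)).Local v))
    (νG : ∀ v : HeightOneSpectrum (𝓞 ↥(maximalRealSubfield L)), Measure ((UnitaryGroup.cmDatum L 3 H').Local v))
    [∀ v, IsFiniteMeasureOnCompacts (νH v)] [∀ v, (νH v).IsMulRightInvariant]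
    [∀ v, (νG v).IsHaarMeasure] [∀ v, (νG v).IsMulRightInvariant]  -- MAIN-b's strength (F2): `νG_v` Haar
    (νGi : Measure (UnitaryGroup.arch (↥(maximalRealSubfield L)) L (IsCMField.complexConj L) 3 H')) (νqi : Measure (UnitaryGroup.arch (↥(maximalRealSubfield L)) L (IsCMField.complexConj L) 3 (Matrix.of fun i j : Fin 3 => if i.val + j.val + 1 = 3 then (1 : L) else 0)))
    (νHi : Measure (UnitaryGroup.arch (↥(maximalRealSubfield L)) L (IsCMField.complexConj L) 2 (Matrix.of fun i j : Fin 2 => if i.val + j.val + 1 = 2 then (1 : L) else 0) ×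
          UnitaryGroup.arch (↥(maximalRealSubfield L)) L (IsCMField.complexConj L) 1 (Matrix.of fun i j : Fin 1 => if i.val + j.val + 1 = 1 then (1 : L) else 0)))
    [IsFiniteMeasureOnCompacts νGi] [νGi.IsMulRightInvariant] [IsFiniteMeasureOnCompacts νqi] [νqi.IsMulRightInvariant]
    [IsFiniteMeasureOnCompacts νHi] [νHi.IsMulRightInvariant]

/-! ## §2 THE CERTIFICATE «O1 ⟸ O4♮ ∧ ARCH-κ-SIGN∀» (organ texts VERBATIM) -/

omit [∀ g : (UnitaryGroup.cmDatum L 3 H').Adelic, MeasurableSpace ((UnitaryGroup.cmDatum L 3 H').Adelic ⧸ Subgroup.centralizer ({g} : Set (UnitaryGroup.cmDatum L 3 H').Adelic))]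
  [∀ g : (UnitaryGroup.cmDatum L 3 H').Adelic, BorelSpace ((UnitaryGroup.cmDatum L 3 H').Adelic ⧸ Subgroup.centralizer ({g} : Set (UnitaryGroup.cmDatum L 3 H').Adelic))] in
set_option maxHeartbeats 16000000 in
set_option synthInstance.maxHeartbeats 800000 in
-- HB: the statement carries the organ texts O4♮ (with the (T′) tower of ★ p844690), ARCH-κ-SIGN∀ and O1 — the letter's own budget (★ p848619 ∕ p848810)
/-- **THE «O1-DEDUP CERTIFICATE»: O1 «κ-SYSTEM» ⟸ O4♮ «T′-κ-SYSTEM» ∧ ARCH-κ-SIGN∀** [Rogawski1990 §8.2 Prop. 8.2.1 (a), (b) p. 118; §14.5 L. 14.5.2 (b) pp. 238–239; §1.7 p. 6, p. 11;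
§4.3 pp. 43–44].  Hypotheses: `href` = the leaf's organ O4♮ `stub_tprimeKappaSystem` TOKEN FOR TOKEN (print's one witness `(mGs₀, tGs₀)`: (Q-fin)₀ ∧ (COH-fin)₀ ∧ (LEV)₀ ∧ (κ-loc-Q)₀ ∧ (T′)₀;
(T′)₀ unread); `hAKS` = ARCH-κ-SIGN∀ (uniform frame prefix; for every (Q-fin)+(COH-fin)+(LEV) system and every κ-block datum, the finite (κ-loc) letters alone imply the κ-BLOCK-TF —
(κ-arch) [Prop. 8.2.1 (a) archimedean ∕ L. 14.5.2 (b)] and (κ-sign) [Prop. 8.2.1 (b)], the organ re-picking the finite constants).  Conclusion = the leaf's organ O1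
`stub_finPartners_kappaSystem` TOKEN FOR TOKEN.  Proof: CENTRAL REPAIR of print's partners by the level-mass rescaling at the rational-scalar images (module docstring), ARCH-κ-SIGN∀
on print's own system, κ-block transport to the rescaled members class by class (★ `stableOrbitalIntegralRel_congr_measure`; the rescaling is trivial on every class the letters read).
[cite: Rogawski1990, §8.2 Prop. 8.2.1 (a), (b) p. 118; §14.5 Lemma 14.5.2 (b) pp. 238–239; §1.7 p. 6, p. 11; §4.3 (4.3.1) pp. 43–44; Prop. 10.1.2 (b) p. 153] [cite: Kottwitz1988, §1, Prop. 2]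
[cite: DeitmarEchterhoff2014, Thm. 1.5.3] -/
theorem finPartners_kappaSystem_of_reference_of_archSign
    (href : ∀ (hK : ∀ v : HeightOneSpectrum (𝓞 ↥(maximalRealSubfield L)), νG v (UnitaryGroup.cmLocalIntegralLevel L 3 H' v : Set ((UnitaryGroup.cmDatum L 3 H').Local v)) = 1)
      (hanis : ∀ x : Fin 3 → L, hermForm (cmConjRingHom L) H' x x = 0 → x = 0)
      (Sbad : Finset (HeightOneSpectrum (𝓞 ↥(maximalRealSubfield L))))
          (Δ : ∀ v : HeightOneSpectrum (𝓞 ↥(maximalRealSubfield L)), LocalTransferFactor L H' v)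
          (mH : ∀ v : HeightOneSpectrum (𝓞 ↥(maximalRealSubfield L)),
            OrbitalMeasureFamily ((UnitaryGroup.cmDatum L 2 (Matrix.of fun i j : Fin 2 => if i.val + j.val + 1 = 2 then (1 : L) else 0)).Local v ×
              (UnitaryGroup.cmDatum L 1 (Matrix.of fun i j : Fin 1 => if i.val + j.val + 1 = 1 then (1 : L) else 0)).Local v))
          (mG : ∀ v : HeightOneSpectrum (𝓞 ↥(maximalRealSubfield L)), OrbitalMeasureFamily ((UnitaryGroup.cmDatum L 3 H').Local v))
      (m' : OrbitalMeasureFamily (UnitaryGroup.arch (↥(maximalRealSubfield L)) L (IsCMField.complexConj L) 3 H'))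
            (m : OrbitalMeasureFamily (UnitaryGroup.arch (↥(maximalRealSubfield L)) L (IsCMField.complexConj L) 3
              (Matrix.of fun i j : Fin 3 => if i.val + j.val + 1 = 3 then (1 : L) else 0)))
            (mHi : OrbitalMeasureFamily (UnitaryGroup.arch (↥(maximalRealSubfield L)) L (IsCMField.complexConj L) 2
                (Matrix.of fun i j : Fin 2 => if i.val + j.val + 1 = 2 then (1 : L) else 0) ×
              UnitaryGroup.arch (↥(maximalRealSubfield L)) L (IsCMField.complexConj L) 1
                (Matrix.of fun i j : Fin 1 => if i.val + j.val + 1 = 1 then (1 : L) else 0)))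
            (t' : ∀ γ' : UnitaryGroup.arch (↥(maximalRealSubfield L)) L (IsCMField.complexConj L) 3 H',
              Measure (Subgroup.centralizer ({γ'} : Set (UnitaryGroup.arch (↥(maximalRealSubfield L)) L (IsCMField.complexConj L) 3 H'))))
            (t : ∀ γ : UnitaryGroup.arch (↥(maximalRealSubfield L)) L (IsCMField.complexConj L) 3
                (Matrix.of fun i j : Fin 3 => if i.val + j.val + 1 = 3 then (1 : L) else 0),
              Measure (Subgroup.centralizer ({γ} : Set (UnitaryGroup.arch (↥(maximalRealSubfield L)) L (IsCMField.complexConj L) 3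
                (Matrix.of fun i j : Fin 3 => if i.val + j.val + 1 = 3 then (1 : L) else 0)))))
            (tH : ∀ γH : UnitaryGroup.arch (↥(maximalRealSubfield L)) L (IsCMField.complexConj L) 2
                  (Matrix.of fun i j : Fin 2 => if i.val + j.val + 1 = 2 then (1 : L) else 0) ×
                UnitaryGroup.arch (↥(maximalRealSubfield L)) L (IsCMField.complexConj L) 1
                  (Matrix.of fun i j : Fin 1 => if i.val + j.val + 1 = 1 then (1 : L) else 0),
              Measure (Subgroup.centralizer ({γH} : Set (UnitaryGroup.arch (↥(maximalRealSubfield L)) L (IsCMField.complexConj L) 2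
                  (Matrix.of fun i j : Fin 2 => if i.val + j.val + 1 = 2 then (1 : L) else 0) ×
                UnitaryGroup.arch (↥(maximalRealSubfield L)) L (IsCMField.complexConj L) 1
                  (Matrix.of fun i j : Fin 1 => if i.val + j.val + 1 = 1 then (1 : L) else 0)))))
        (hherm : (H'.map (cmConjRingHom L)).transpose = H')
        (hCTM : CanonicalTransferMatrix L H' Tinf.Δ νH νG Sbad Δ mH mG)
        (hACS : ArchCanonicalSingularMatrix L H' Tinf νGi νqi νHi hanis m' m mHi t' t tH),
        ∃ (mGs₀ : ∀ v : HeightOneSpectrum (𝓞 ↥(maximalRealSubfield L)), OrbitalMeasureFamily ((UnitaryGroup.cmDatum L 3 H').Local v))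
          (tGs₀ : ∀ (v : HeightOneSpectrum (𝓞 ↥(maximalRealSubfield L))) (γ : (UnitaryGroup.cmDatum L 3 H').Local v), Measure ↥(Subgroup.centralizer ({γ} : Set ((UnitaryGroup.cmDatum L 3 H').Local v)))),
          (∀ v, (mGs₀ v).IsQuotientOf (fun x : (UnitaryGroup.cmDatum L 3 H').Local v => ∃ γ₀ : (UnitaryGroup.cmDatum L 3 H').Rational, ¬ IsRegularElt (γ₀.val : GL (Fin 3) L) ∧
                Corresponds (UnitaryGroup.conjLocal L (IsCMField.complexConj L) v)
                  ((UnitaryGroup.adelicForm L 3 H').map (UnitaryGroup.adeleToLocal L v))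
                  ((UnitaryGroup.adelicForm L 3 H').map (UnitaryGroup.adeleToLocal L v))
                  ((UnitaryGroup.cmDatum L 3 H').toLocal v ((UnitaryGroup.cmDatum L 3 H').toAdelic γ₀)) x) (νG v) (tGs₀ v)) ∧
          (∀ (v : HeightOneSpectrum (𝓞 ↥(maximalRealSubfield L))) (γ₁ γ₂ q : (UnitaryGroup.cmDatum L 3 H').Local v) (hq : (MulAut.conj q : (UnitaryGroup.cmDatum L 3 H').Local v ≃* (UnitaryGroup.cmDatum L 3 H').Local v) γ₁ = γ₂),
            (∃ γ₀ : (UnitaryGroup.cmDatum L 3 H').Rational, ¬ IsRegularElt (γ₀.val : GL (Fin 3) L) ∧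
                Corresponds (UnitaryGroup.conjLocal L (IsCMField.complexConj L) v)
                  ((UnitaryGroup.adelicForm L 3 H').map (UnitaryGroup.adeleToLocal L v))
                  ((UnitaryGroup.adelicForm L 3 H').map (UnitaryGroup.adeleToLocal L v))
                  ((UnitaryGroup.cmDatum L 3 H').toLocal v ((UnitaryGroup.cmDatum L 3 H').toAdelic γ₀)) γ₁) →
            Measure.map (subgroupCongrHomeomorph (MulAut.conj q : (UnitaryGroup.cmDatum L 3 H').Local v ≃* (UnitaryGroup.cmDatum L 3 H').Local v) (Subgroup.centralizer ({γ₁} : Set ((UnitaryGroup.cmDatum L 3 H').Local v)))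
              (Subgroup.centralizer ({γ₂} : Set ((UnitaryGroup.cmDatum L 3 H').Local v))) (forall_apply_mem_centralizer_singleton_iff_of_eq (MulAut.conj q : (UnitaryGroup.cmDatum L 3 H').Local v ≃* (UnitaryGroup.cmDatum L 3 H').Local v) hq)
              (continuous_mulAutConj q) (continuous_mulAutConj_symm q)) (tGs₀ v γ₁) = tGs₀ v γ₂) ∧
          (∀ γ₀ : (UnitaryGroup.cmDatum L 3 H').Rational, ¬ IsRegularElt (γ₀.val : GL (Fin 3) L) →
            ∀ᶠ v : HeightOneSpectrum (𝓞 ↥(maximalRealSubfield L)) in Filter.cofinite,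
              tGs₀ v ((UnitaryGroup.cmDatum L 3 H').toLocal v ((UnitaryGroup.cmDatum L 3 H').toAdelic γ₀))
                (Subtype.val ⁻¹' (UnitaryGroup.cmLocalIntegralLevel L 3 H' v : Set ((UnitaryGroup.cmDatum L 3 H').Local v))) = 1) ∧
          (∀ (γ₀ : (UnitaryGroup.cmDatum L 3 H').Rational) (e₁ e₂ : L), e₁ ≠ e₂ →
            ((((γ₀ : unitaryGroup (cmConjRingHom L) H').val : GL (Fin 3) L) : Matrix (Fin 3) (Fin 3) L) - e₁ • (1 : Matrix (Fin 3) (Fin 3) L)) * ((((γ₀ : unitaryGroup (cmConjRingHom L) H').val : GL (Fin 3) L) : Matrix (Fin 3) (Fin 3) L) - e₂ • (1 : Matrix (Fin 3) (Fin 3) L)) = 0 →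
            (¬ ∃ ζ : L, (((γ₀ : unitaryGroup (cmConjRingHom L) H').val : GL (Fin 3) L) : Matrix (Fin 3) (Fin 3) L) = ζ • (1 : Matrix (Fin 3) (Fin 3) L)) →
            (((γ₀ : unitaryGroup (cmConjRingHom L) H').val : GL (Fin 3) L) : Matrix (Fin 3) (Fin 3) L).charpoly =
              (Polynomial.X - Polynomial.C e₁) ^ 2 * (Polynomial.X - Polynomial.C e₂) →
            ∀ (γH : (UnitaryGroup.cmDatum L 2 (Matrix.of fun i j : Fin 2 => if i.val + j.val + 1 = 2 then (1 : L) else 0)).Rational ×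
                (UnitaryGroup.cmDatum L 1 (Matrix.of fun i j : Fin 1 => if i.val + j.val + 1 = 1 then (1 : L) else 0)).Rational),
              (((γH.1 : unitaryGroup (cmConjRingHom L) (Matrix.of fun i j : Fin 2 => if i.val + j.val + 1 = 2 then (1 : L) else 0)).val : GL (Fin 2) L) : Matrix (Fin 2) (Fin 2) L) =
                e₁ • (1 : Matrix (Fin 2) (Fin 2) L) →
              (((γH.2 : unitaryGroup (cmConjRingHom L) (Matrix.of fun i j : Fin 1 => if i.val + j.val + 1 = 1 then (1 : L) else 0)).val : GL (Fin 1) L) : Matrix (Fin 1) (Fin 1) L) 0 0 = e₂ →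
              ∃ (c : HeightOneSpectrum (𝓞 ↥(maximalRealSubfield L)) → ℂ), (∀ v, c v ≠ 0) ∧
                (∀ (v : HeightOneSpectrum (𝓞 ↥(maximalRealSubfield L)))
                      (fH : (UnitaryGroup.cmDatum L 2 (Matrix.of fun i j : Fin 2 => if i.val + j.val + 1 = 2 then (1 : L) else 0)).Local v × (UnitaryGroup.cmDatum L 1 (Matrix.of fun i j : Fin 1 => if i.val + j.val + 1 = 1 then (1 : L) else 0)).Local v → ℂ) (f : (UnitaryGroup.cmDatum L 3 H').Local v → ℂ),
                    IsLocSmooth f → IsLocSmooth fH → IsLocalDeltaTransfer L H' v (Δ v) (mH v) (mG v) fH f →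
                    localStableOrbitalIntegral L 3 H' v (mGs₀ v) f ((UnitaryGroup.cmDatum L 3 H').toLocal v ((UnitaryGroup.cmDatum L 3 H').toAdelic γ₀)) =
                      c v * fH ((UnitaryGroup.cmDatum L 2 (Matrix.of fun i j : Fin 2 => if i.val + j.val + 1 = 2 then (1 : L) else 0)).toLocal v ((UnitaryGroup.cmDatum L 2 (Matrix.of fun i j : Fin 2 => if i.val + j.val + 1 = 2 then (1 : L) else 0)).toAdelic γH.1),
                        (UnitaryGroup.cmDatum L 1 (Matrix.of fun i j : Fin 1 => if i.val + j.val + 1 = 1 then (1 : L) else 0)).toLocal v ((UnitaryGroup.cmDatum L 1 (Matrix.of fun i j : Fin 1 => if i.val + j.val + 1 = 1 then (1 : L) else 0)).toAdelic γH.2)))) ∧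
          (∀ [∀ v : HeightOneSpectrum (𝓞 ↥(maximalRealSubfield L)), MeasurableSpace ↥(UnitaryGroup.localPi L (IsCMField.complexConj L) 3 H' v)]
              [∀ v : HeightOneSpectrum (𝓞 ↥(maximalRealSubfield L)), BorelSpace ↥(UnitaryGroup.localPi L (IsCMField.complexConj L) 3 H' v)]
              [MeasurableSpace ↥(UnitaryGroup.finAdelic (↥(maximalRealSubfield L)) L (IsCMField.complexConj L) 3 H')] [BorelSpace ↥(UnitaryGroup.finAdelic (↥(maximalRealSubfield L)) L (IsCMField.complexConj L) 3 H')]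
              (ψ : ∀ v : HeightOneSpectrum (𝓞 ↥(maximalRealSubfield L)), ↥(UnitaryGroup.localPi L (IsCMField.complexConj L) 3 H' v) ≃ₜ* (UnitaryGroup.cmDatum L 3 H').Local v)
              (hψ : ψ = fun v => UnitaryGroup.localPiEquiv L (IsCMField.complexConj L) 3 H' v)
              (e : ↥(UnitaryGroup.arch (↥(maximalRealSubfield L)) L (IsCMField.complexConj L) 3 H') × ↥(UnitaryGroup.finAdelic (↥(maximalRealSubfield L)) L (IsCMField.complexConj L) 3 H') ≃* (UnitaryGroup.cmDatum L 3 H').Adelic)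
              (_ : e = (UnitaryGroup.adelicProdEquiv (↥(maximalRealSubfield L)) L (IsCMField.complexConj L) 3 H').symm.toMulEquiv) (he : Continuous e) (hes : Continuous e.symm)
              (hg : ∀ g : (UnitaryGroup.cmDatum L 3 H').Adelic, e (UnitaryGroup.archPart (↥(maximalRealSubfield L)) L (IsCMField.complexConj L) 3 H' g, UnitaryGroup.finPart (↥(maximalRealSubfield L)) L (IsCMField.complexConj L) 3 H' g) = g)
              (tA : ∀ c : ConjClasses (UnitaryGroup.cmDatum L 3 H').Rational, Measure (Subgroup.centralizer ({((UnitaryGroup.cmDatum L 3 H').toAdelic (Quotient.out c))} : Set (UnitaryGroup.cmDatum L 3 H').Adelic)))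
              (_ : ∀ c, IsHaarMeasure (tA c)) (_ : ∀ c, (tA c).IsMulRightInvariant) (_ : ∀ c, (tA c).IsInvInvariant),
            (∀ c : ConjClasses (UnitaryGroup.cmDatum L 3 H').Rational, ¬ IsRegularElt ((Quotient.out c).val : GL (Fin 3) L) →
              (¬ ∃ ζ : L, (((Quotient.out c).val : GL (Fin 3) L) : Matrix (Fin 3) (Fin 3) L) = ζ • (1 : Matrix (Fin 3) (Fin 3) L)) →
              ∃ S₀ : Finset (HeightOneSpectrum (𝓞 ↥(maximalRealSubfield L))), UnitaryGroup.IsNormalisedOff L 3 H' mGs₀ ((UnitaryGroup.cmDatum L 3 H').toAdelic (Quotient.out c)) S₀ ∧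
              ∃ (ρ : Measure (cutout (fun v => UnitaryGroup.localInt L (IsCMField.complexConj L) 3 H' v) (fun v => (Subgroup.centralizer ({(UnitaryGroup.finAdelicEquiv (↥(maximalRealSubfield L)) L (IsCMField.complexConj L) 3 H') (UnitaryGroup.finPart (↥(maximalRealSubfield L)) L (IsCMField.complexConj L) 3 H' ((UnitaryGroup.cmDatum L 3 H').toAdelic (Quotient.out c))) v} : Set ↥(UnitaryGroup.localPi L (IsCMField.complexConj L) 3 H' v)))))) (ρM : Measure (Subgroup.centralizer ({(UnitaryGroup.finAdelicEquiv (↥(maximalRealSubfield L)) L (IsCMField.complexConj L) 3 H') (UnitaryGroup.finPart (↥(maximalRealSubfield L)) L (IsCMField.complexConj L) 3 H' ((UnitaryGroup.cmDatum L 3 H').toAdelic (Quotient.out c)))} : Set (Πʳ v : HeightOneSpectrum (𝓞 ↥(maximalRealSubfield L)), [↥(UnitaryGroup.localPi L (IsCMField.complexConj L) 3 H' v), UnitaryGroup.localInt L (IsCMField.complexConj L) 3 H' v])))) (tf : Measure (Subgroup.centralizer ({(UnitaryGroup.finPart (↥(maximalRealSubfield L)) L (IsCMField.complexConj L) 3 H'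 ((UnitaryGroup.cmDatum L 3 H').toAdelic (Quotient.out c)))} : Set (UnitaryGroup.finAdelic (↥(maximalRealSubfield L)) L (IsCMField.complexConj L) 3 H'))))
                (tP : Measure ((Subgroup.centralizer ({UnitaryGroup.archPart (↥(maximalRealSubfield L)) L (IsCMField.complexConj L) 3 H' ((UnitaryGroup.cmDatum L 3 H').toAdelic (Quotient.out c))} : Set (UnitaryGroup.arch (↥(maximalRealSubfield L)) L (IsCMField.complexConj L) 3 H'))).prod (Subgroup.centralizer ({(UnitaryGroup.finPart (↥(maximalRealSubfield L)) L (IsCMField.complexConj L) 3 H' ((UnitaryGroup.cmDatum L 3 H').toAdelic (Quotient.out c)))} : Set (UnitaryGroup.finAdelic (↥(maximalRealSubfield L)) L (IsCMField.complexConj L) 3 H'))))),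
                (∀ v, v ∉ S₀ → (Measure.map (subgroupCongrHomeomorph (ψ v).symm.toMulEquiv (Subgroup.centralizer ({((UnitaryGroup.cmDatum L 3 H').toLocal v ((UnitaryGroup.cmDatum L 3 H').toAdelic (Quotient.out c)))} : Set ((UnitaryGroup.cmDatum L 3 H').Local v))) (Subgroup.centralizer ({(UnitaryGroup.finAdelicEquiv (↥(maximalRealSubfield L)) L (IsCMField.complexConj L) 3 H') (UnitaryGroup.finPart (↥(maximalRealSubfield L)) L (IsCMField.complexConj L) 3 H' ((UnitaryGroup.cmDatum L 3 H').toAdelic (Quotient.out c))) v} : Set ↥(UnitaryGroup.localPi L (IsCMField.complexConj L) 3 H' v))) (UnitaryGroup.localPiEquiv_symm_mem_centralizer_iff L 3 H' v ((UnitaryGroup.cmDatum L 3 H').toAdelic (Quotient.out c)) (ψ v) (congrFun hψ v)) (ψ v).symm.continuous (ψ v).continuous) (tGs₀ v ((UnitaryGroup.cmDatum L 3 H').toLocal v ((UnitaryGroup.cmDatum L 3 H').toAdelic (Quotient.out c))))) ((((inH (fun v => UnitaryGroup.localInt L (IsCMField.complexConj L) 3 H' v) (fun v => (Subgroup.centralizer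 ({(UnitaryGroup.finAdelicEquiv (↥(maximalRealSubfield L)) L (IsCMField.complexConj L) 3 H') (UnitaryGroup.finPart (↥(maximalRealSubfield L)) L (IsCMField.complexConj L) 3 H' ((UnitaryGroup.cmDatum L 3 H').toAdelic (Quotient.out c))) v} : Set ↥(UnitaryGroup.localPi L (IsCMField.complexConj L) 3 H' v)))) v) : Subgroup (Subgroup.centralizer ({(UnitaryGroup.finAdelicEquiv (↥(maximalRealSubfield L)) L (IsCMField.complexConj L) 3 H') (UnitaryGroup.finPart (↥(maximalRealSubfield L)) L (IsCMField.complexConj L) 3 H' ((UnitaryGroup.cmDatum L 3 H').toAdelic (Quotient.out c))) v} : Set ↥(UnitaryGroup.localPi L (IsCMField.complexConj L) 3 H' v)))) : Set (Subgroup.centralizer ({(UnitaryGroup.finAdelicEquiv (↥(maximalRealSubfield L)) L (IsCMField.complexConj L) 3 H') (UnitaryGroup.finPart (↥(maximalRealSubfield L)) L (IsCMField.complexConj L) 3 H' ((UnitaryGroup.cmDatum L 3 H').toAdelic (Quotient.out c))) v} : Set ↥(UnitaryGroup.localPi L (IsCMField.complexConj L) 3 H' v))))) = 1) ∧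
                ρ = Measure.map (cutoutEquiv (fun v => UnitaryGroup.localInt L (IsCMField.complexConj L) 3 H' v) (fun v => (Subgroup.centralizer ({(UnitaryGroup.finAdelicEquiv (↥(maximalRealSubfield L)) L (IsCMField.complexConj L) 3 H') (UnitaryGroup.finPart (↥(maximalRealSubfield L)) L (IsCMField.complexConj L) 3 H' ((UnitaryGroup.cmDatum L 3 H').toAdelic (Quotient.out c))) v} : Set ↥(UnitaryGroup.localPi L (IsCMField.complexConj L) 3 H' v)))))
                (rpMeasure (fun v => (((inH (fun v => UnitaryGroup.localInt L (IsCMField.complexConj L) 3 H' v) (fun v => (Subgroup.centralizer ({(UnitaryGroup.finAdelicEquiv (↥(maximalRealSubfield L)) L (IsCMField.complexConj L) 3 H') (UnitaryGroup.finPart (↥(maximalRealSubfield L)) L (IsCMField.complexConj L) 3 H' ((UnitaryGroup.cmDatum L 3 H').toAdelic (Quotient.out c))) v} : Set ↥(UnitaryGroup.localPi L (IsCMField.complexConj L) 3 H' v)))) v) : Subgroup (Subgroup.centralizer ({(UnitaryGroup.finAdelicEquiv (↥(maximalRealSubfield L)) L (IsCMField.complexConj L) 3 H') (UnitaryGroup.finPart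 (↥(maximalRealSubfield L)) L (IsCMField.complexConj L) 3 H' ((UnitaryGroup.cmDatum L 3 H').toAdelic (Quotient.out c))) v} : Set ↥(UnitaryGroup.localPi L (IsCMField.complexConj L) 3 H' v)))) : Set (Subgroup.centralizer ({(UnitaryGroup.finAdelicEquiv (↥(maximalRealSubfield L)) L (IsCMField.complexConj L) 3 H') (UnitaryGroup.finPart (↥(maximalRealSubfield L)) L (IsCMField.complexConj L) 3 H' ((UnitaryGroup.cmDatum L 3 H').toAdelic (Quotient.out c))) v} : Set ↥(UnitaryGroup.localPi L (IsCMField.complexConj L) 3 H' v))))) (fun v => (Measure.map (subgroupCongrHomeomorph (ψ v).symm.toMulEquiv (Subgroup.centralizer ({((UnitaryGroup.cmDatum L 3 H').toLocal v ((UnitaryGroup.cmDatum L 3 H').toAdelic (Quotient.out c)))} : Set ((UnitaryGroup.cmDatum L 3 H').Local v))) (Subgroup.centralizer ({(UnitaryGroup.finAdelicEquiv (↥(maximalRealSubfield L)) L (IsCMField.complexConj L) 3 H') (UnitaryGroup.finPart (↥(maximalRealSubfield L)) L (IsCMField.complexConj L) 3 H' ((UnitaryGroup.cmDatum L 3 H').toAdelic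 (Quotient.out c))) v} : Set ↥(UnitaryGroup.localPi L (IsCMField.complexConj L) 3 H' v))) (UnitaryGroup.localPiEquiv_symm_mem_centralizer_iff L 3 H' v ((UnitaryGroup.cmDatum L 3 H').toAdelic (Quotient.out c)) (ψ v) (congrFun hψ v)) (ψ v).symm.continuous (ψ v).continuous) (tGs₀ v ((UnitaryGroup.cmDatum L 3 H').toLocal v ((UnitaryGroup.cmDatum L 3 H').toAdelic (Quotient.out c)))))) S₀) ∧
                ρM = Measure.map (subgroupCongrHomeomorph (MulEquiv.refl (Πʳ v : HeightOneSpectrum (𝓞 ↥(maximalRealSubfield L)), [↥(UnitaryGroup.localPi L (IsCMField.complexConj L) 3 H' v), UnitaryGroup.localInt L (IsCMField.complexConj L) 3 H' v])) (cutout (fun v => UnitaryGroup.localInt L (IsCMField.complexConj L) 3 H' v) (fun v => (Subgroup.centralizer ({(UnitaryGroup.finAdelicEquiv (↥(maximalRealSubfield L)) L (IsCMField.complexConj L) 3 H') (UnitaryGroup.finPart (↥(maximalRealSubfield L)) L (IsCMField.complexConj L) 3 H' ((UnitaryGroup.cmDatum L 3 H').toAdelic (Quotient.out c))) v} : Set ↥(UnitaryGroup.localPi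 L (IsCMField.complexConj L) 3 H' v))))) (Subgroup.centralizer ({(UnitaryGroup.finAdelicEquiv (↥(maximalRealSubfield L)) L (IsCMField.complexConj L) 3 H') (UnitaryGroup.finPart (↥(maximalRealSubfield L)) L (IsCMField.complexConj L) 3 H' ((UnitaryGroup.cmDatum L 3 H').toAdelic (Quotient.out c)))} : Set (Πʳ v : HeightOneSpectrum (𝓞 ↥(maximalRealSubfield L)), [↥(UnitaryGroup.localPi L (IsCMField.complexConj L) 3 H' v), UnitaryGroup.localInt L (IsCMField.complexConj L) 3 H' v]))) (forall_refl_mem_iff (fun v => UnitaryGroup.localInt L (IsCMField.complexConj L) 3 H' v) (fun v => (Subgroup.centralizer ({(UnitaryGroup.finAdelicEquiv (↥(maximalRealSubfield L)) L (IsCMField.complexConj L) 3 H') (UnitaryGroup.finPart (↥(maximalRealSubfield L)) L (IsCMField.complexConj L) 3 H' ((UnitaryGroup.cmDatum L 3 H').toAdelic (Quotient.out c))) v} : Set ↥(UnitaryGroup.localPi L (IsCMField.complexConj L) 3 H' v)))) _ (mem_centralizer_singleton_iff_forall_mem (fun v => UnitaryGroup.localInt L (IsCMField.complexConj L) 3 H'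 v) ((UnitaryGroup.finAdelicEquiv (↥(maximalRealSubfield L)) L (IsCMField.complexConj L) 3 H') (UnitaryGroup.finPart (↥(maximalRealSubfield L)) L (IsCMField.complexConj L) 3 H' ((UnitaryGroup.cmDatum L 3 H').toAdelic (Quotient.out c)))))) continuous_id continuous_id) ρ ∧
                tf = Measure.map (subgroupCongrHomeomorph (UnitaryGroup.finAdelicEquiv (↥(maximalRealSubfield L)) L (IsCMField.complexConj L) 3 H').symm.toMulEquiv (Subgroup.centralizer ({(UnitaryGroup.finAdelicEquiv (↥(maximalRealSubfield L)) L (IsCMField.complexConj L) 3 H') (UnitaryGroup.finPart (↥(maximalRealSubfield L)) L (IsCMField.complexConj L) 3 H' ((UnitaryGroup.cmDatum L 3 H').toAdelic (Quotient.out c)))} : Set (Πʳ v : HeightOneSpectrum (𝓞 ↥(maximalRealSubfield L)), [↥(UnitaryGroup.localPi L (IsCMField.complexConj L) 3 H' v), UnitaryGroup.localInt L (IsCMField.complexConj L) 3 H' v]))) (Subgroup.centralizer ({(UnitaryGroup.finPart (↥(maximalRealSubfield L)) L (IsCMField.complexConj L) 3 H' ((UnitaryGroup.cmDatum L 3 H').toAdelic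 (Quotient.out c)))} : Set (UnitaryGroup.finAdelic (↥(maximalRealSubfield L)) L (IsCMField.complexConj L) 3 H'))) (forall_apply_mem_centralizer_singleton_iff_of_eq (UnitaryGroup.finAdelicEquiv (↥(maximalRealSubfield L)) L (IsCMField.complexConj L) 3 H').symm.toMulEquiv ((UnitaryGroup.finAdelicEquiv (↥(maximalRealSubfield L)) L (IsCMField.complexConj L) 3 H').symm_apply_apply (UnitaryGroup.finPart (↥(maximalRealSubfield L)) L (IsCMField.complexConj L) 3 H' ((UnitaryGroup.cmDatum L 3 H').toAdelic (Quotient.out c))))) (UnitaryGroup.finAdelicEquiv (↥(maximalRealSubfield L)) L (IsCMField.complexConj L) 3 H').symm.continuous (UnitaryGroup.finAdelicEquiv (↥(maximalRealSubfield L)) L (IsCMField.complexConj L) 3 H').continuous) ρM ∧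
                Measure.map (Subgroup.prodEquiv (Subgroup.centralizer ({UnitaryGroup.archPart (↥(maximalRealSubfield L)) L (IsCMField.complexConj L) 3 H' ((UnitaryGroup.cmDatum L 3 H').toAdelic (Quotient.out c))} : Set (UnitaryGroup.arch (↥(maximalRealSubfield L)) L (IsCMField.complexConj L) 3 H'))) (Subgroup.centralizer ({(UnitaryGroup.finPart (↥(maximalRealSubfield L)) L (IsCMField.complexConj L) 3 H' ((UnitaryGroup.cmDatum L 3 H').toAdelic (Quotient.out c)))} : Set (UnitaryGroup.finAdelic (↥(maximalRealSubfield L)) L (IsCMField.complexConj L) 3 H')))) tP = (Literature.NumberTheory.Weil1964.UnitaryArchTopForm.centralizerTopFormHaar L H' (UnitaryGroup.archPart (↥(maximalRealSubfield L)) L (IsCMField.complexConj L) 3 H' ((UnitaryGroup.cmDatum L 3 H').toAdelic (Quotient.out c)))).prod tf ∧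
                tA c = Measure.map (subgroupCongrHomeomorph e ((Subgroup.centralizer ({UnitaryGroup.archPart (↥(maximalRealSubfield L)) L (IsCMField.complexConj L) 3 H' ((UnitaryGroup.cmDatum L 3 H').toAdelic (Quotient.out c))} : Set (UnitaryGroup.arch (↥(maximalRealSubfield L)) L (IsCMField.complexConj L) 3 H'))).prod (Subgroup.centralizer ({(UnitaryGroup.finPart (↥(maximalRealSubfield L)) L (IsCMField.complexConj L) 3 H' ((UnitaryGroup.cmDatum L 3 H').toAdelic (Quotient.out c)))} : Set (UnitaryGroup.finAdelic (↥(maximalRealSubfield L)) L (IsCMField.complexConj L) 3 H')))) (Subgroup.centralizer ({((UnitaryGroup.cmDatum L 3 H').toAdelic (Quotient.out c))} : Set (UnitaryGroup.cmDatum L 3 H').Adelic)) (forall_apply_mem_centralizer_iff e (hg ((UnitaryGroup.cmDatum L 3 H').toAdelic (Quotient.out c)))) he hes) tP) →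
            ∀ c c' : ConjClasses (UnitaryGroup.cmDatum L 3 H').Rational, ¬ IsRegularElt ((Quotient.out c).val : GL (Fin 3) L) →
              (¬ ∃ ζ : L, (((Quotient.out c).val : GL (Fin 3) L) : Matrix (Fin 3) (Fin 3) L) = ζ • (1 : Matrix (Fin 3) (Fin 3) L)) →
              ¬ IsRegularElt ((Quotient.out c').val : GL (Fin 3) L) →
              (¬ ∃ ζ : L, (((Quotient.out c').val : GL (Fin 3) L) : Matrix (Fin 3) (Fin 3) L) = ζ • (1 : Matrix (Fin 3) (Fin 3) L)) →
              StableClass.ofConjClass c = StableClass.ofConjClass c' →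
              quotientMeasure (((UnitaryGroup.cmDatum L 3 H').quotientSubgroup ⊓
                    Subgroup.centralizer ({(UnitaryGroup.cmDatum L 3 H').toAdelic (Quotient.out c)} : Set (UnitaryGroup.cmDatum L 3 H').Adelic)).subgroupOf
                    (Subgroup.centralizer ({(UnitaryGroup.cmDatum L 3 H').toAdelic (Quotient.out c)} : Set (UnitaryGroup.cmDatum L 3 H').Adelic))) count
                    (isClosed_subgroupOf _ _ ((UnitaryGroup.isClosed_cmDatum_quotientSubgroup L 3 H').inter (hCcl _))) (tA c) Set.univ =
                quotientMeasure (((UnitaryGroup.cmDatum L 3 H').quotientSubgroup ⊓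
                    Subgroup.centralizer ({(UnitaryGroup.cmDatum L 3 H').toAdelic (Quotient.out c')} : Set (UnitaryGroup.cmDatum L 3 H').Adelic)).subgroupOf
                    (Subgroup.centralizer ({(UnitaryGroup.cmDatum L 3 H').toAdelic (Quotient.out c')} : Set (UnitaryGroup.cmDatum L 3 H').Adelic))) count
                    (isClosed_subgroupOf _ _ ((UnitaryGroup.isClosed_cmDatum_quotientSubgroup L 3 H').inter (hCcl _))) (tA c') Set.univ))
    (hAKS : ∀ (hK : ∀ v : HeightOneSpectrum (𝓞 ↥(maximalRealSubfield L)), νG v (UnitaryGroup.cmLocalIntegralLevel L 3 H' v : Set ((UnitaryGroup.cmDatum L 3 H').Local v)) = 1)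
      (hanis : ∀ x : Fin 3 → L, hermForm (cmConjRingHom L) H' x x = 0 → x = 0)
      (Sbad : Finset (HeightOneSpectrum (𝓞 ↥(maximalRealSubfield L))))
          (Δ : ∀ v : HeightOneSpectrum (𝓞 ↥(maximalRealSubfield L)), LocalTransferFactor L H' v)
          (mH : ∀ v : HeightOneSpectrum (𝓞 ↥(maximalRealSubfield L)),
            OrbitalMeasureFamily ((UnitaryGroup.cmDatum L 2 (Matrix.of fun i j : Fin 2 => if i.val + j.val + 1 = 2 then (1 : L) else 0)).Local v ×
              (UnitaryGroup.cmDatum L 1 (Matrix.of fun i j : Fin 1 => if i.val + j.val + 1 = 1 then (1 : L) else 0)).Local v))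
          (mG : ∀ v : HeightOneSpectrum (𝓞 ↥(maximalRealSubfield L)), OrbitalMeasureFamily ((UnitaryGroup.cmDatum L 3 H').Local v))
      (m' : OrbitalMeasureFamily (UnitaryGroup.arch (↥(maximalRealSubfield L)) L (IsCMField.complexConj L) 3 H'))
            (m : OrbitalMeasureFamily (UnitaryGroup.arch (↥(maximalRealSubfield L)) L (IsCMField.complexConj L) 3
              (Matrix.of fun i j : Fin 3 => if i.val + j.val + 1 = 3 then (1 : L) else 0)))
            (mHi : OrbitalMeasureFamily (UnitaryGroup.arch (↥(maximalRealSubfield L)) L (IsCMField.complexConj L) 2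
                (Matrix.of fun i j : Fin 2 => if i.val + j.val + 1 = 2 then (1 : L) else 0) ×
              UnitaryGroup.arch (↥(maximalRealSubfield L)) L (IsCMField.complexConj L) 1
                (Matrix.of fun i j : Fin 1 => if i.val + j.val + 1 = 1 then (1 : L) else 0)))
            (t' : ∀ γ' : UnitaryGroup.arch (↥(maximalRealSubfield L)) L (IsCMField.complexConj L) 3 H',
              Measure (Subgroup.centralizer ({γ'} : Set (UnitaryGroup.arch (↥(maximalRealSubfield L)) L (IsCMField.complexConj L) 3 H'))))
            (t : ∀ γ : UnitaryGroup.arch (↥(maximalRealSubfield L)) L (IsCMField.complexConj L) 3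
                (Matrix.of fun i j : Fin 3 => if i.val + j.val + 1 = 3 then (1 : L) else 0),
              Measure (Subgroup.centralizer ({γ} : Set (UnitaryGroup.arch (↥(maximalRealSubfield L)) L (IsCMField.complexConj L) 3
                (Matrix.of fun i j : Fin 3 => if i.val + j.val + 1 = 3 then (1 : L) else 0)))))
            (tH : ∀ γH : UnitaryGroup.arch (↥(maximalRealSubfield L)) L (IsCMField.complexConj L) 2
                  (Matrix.of fun i j : Fin 2 => if i.val + j.val + 1 = 2 then (1 : L) else 0) ×
                UnitaryGroup.arch (↥(maximalRealSubfield L)) L (IsCMField.complexConj L) 1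
                  (Matrix.of fun i j : Fin 1 => if i.val + j.val + 1 = 1 then (1 : L) else 0),
              Measure (Subgroup.centralizer ({γH} : Set (UnitaryGroup.arch (↥(maximalRealSubfield L)) L (IsCMField.complexConj L) 2
                  (Matrix.of fun i j : Fin 2 => if i.val + j.val + 1 = 2 then (1 : L) else 0) ×
                UnitaryGroup.arch (↥(maximalRealSubfield L)) L (IsCMField.complexConj L) 1
                  (Matrix.of fun i j : Fin 1 => if i.val + j.val + 1 = 1 then (1 : L) else 0)))))
        (hherm : (H'.map (cmConjRingHom L)).transpose = H')
        (hCTM : CanonicalTransferMatrix L H' Tinf.Δ νH νG Sbad Δ mH mG)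
        (hACS : ArchCanonicalSingularMatrix L H' Tinf νGi νqi νHi hanis m' m mHi t' t tH),
        ∀ (mGs₀ : ∀ v : HeightOneSpectrum (𝓞 ↥(maximalRealSubfield L)), OrbitalMeasureFamily ((UnitaryGroup.cmDatum L 3 H').Local v))
          (tGs₀ : ∀ (v : HeightOneSpectrum (𝓞 ↥(maximalRealSubfield L))) (γ : (UnitaryGroup.cmDatum L 3 H').Local v), Measure ↥(Subgroup.centralizer ({γ} : Set ((UnitaryGroup.cmDatum L 3 H').Local v)))),
          -- (Q-fin)₀ VERBATIM
          (∀ v, (mGs₀ v).IsQuotientOf (fun x : (UnitaryGroup.cmDatum L 3 H').Local v => ∃ γ₀ : (UnitaryGroup.cmDatum L 3 H').Rational, ¬ IsRegularElt (γ₀.val : GL (Fin 3) L) ∧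
                Corresponds (UnitaryGroup.conjLocal L (IsCMField.complexConj L) v)
                  ((UnitaryGroup.adelicForm L 3 H').map (UnitaryGroup.adeleToLocal L v))
                  ((UnitaryGroup.adelicForm L 3 H').map (UnitaryGroup.adeleToLocal L v))
                  ((UnitaryGroup.cmDatum L 3 H').toLocal v ((UnitaryGroup.cmDatum L 3 H').toAdelic γ₀)) x) (νG v) (tGs₀ v)) →
          -- (COH-fin)₀ VERBATIM
          (∀ (v : HeightOneSpectrum (𝓞 ↥(maximalRealSubfield L))) (γ₁ γ₂ q : (UnitaryGroup.cmDatum L 3 H').Local v) (hq : (MulAut.conj q : (UnitaryGroup.cmDatum L 3 H').Local v ≃* (UnitaryGroup.cmDatum L 3 H').Local v) γ₁ = γ₂),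
            (∃ γ₀ : (UnitaryGroup.cmDatum L 3 H').Rational, ¬ IsRegularElt (γ₀.val : GL (Fin 3) L) ∧
                Corresponds (UnitaryGroup.conjLocal L (IsCMField.complexConj L) v)
                  ((UnitaryGroup.adelicForm L 3 H').map (UnitaryGroup.adeleToLocal L v))
                  ((UnitaryGroup.adelicForm L 3 H').map (UnitaryGroup.adeleToLocal L v))
                  ((UnitaryGroup.cmDatum L 3 H').toLocal v ((UnitaryGroup.cmDatum L 3 H').toAdelic γ₀)) γ₁) →
            Measure.map (subgroupCongrHomeomorph (MulAut.conj q : (UnitaryGroup.cmDatum L 3 H').Local v ≃* (UnitaryGroup.cmDatum L 3 H').Local v) (Subgroup.centralizer ({γ₁} : Set ((UnitaryGroup.cmDatum L 3 H').Local v)))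
              (Subgroup.centralizer ({γ₂} : Set ((UnitaryGroup.cmDatum L 3 H').Local v))) (forall_apply_mem_centralizer_singleton_iff_of_eq (MulAut.conj q : (UnitaryGroup.cmDatum L 3 H').Local v ≃* (UnitaryGroup.cmDatum L 3 H').Local v) hq)
              (continuous_mulAutConj q) (continuous_mulAutConj_symm q)) (tGs₀ v γ₁) = tGs₀ v γ₂) →
          -- (LEV)₀ VERBATIM
          (∀ γ₀ : (UnitaryGroup.cmDatum L 3 H').Rational, ¬ IsRegularElt (γ₀.val : GL (Fin 3) L) →
            ∀ᶠ v : HeightOneSpectrum (𝓞 ↥(maximalRealSubfield L)) in Filter.cofinite,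
              tGs₀ v ((UnitaryGroup.cmDatum L 3 H').toLocal v ((UnitaryGroup.cmDatum L 3 H').toAdelic γ₀))
                (Subtype.val ⁻¹' (UnitaryGroup.cmLocalIntegralLevel L 3 H' v : Set ((UnitaryGroup.cmDatum L 3 H').Local v))) = 1) →
          -- the κ-block binders VERBATIM; antecedent (κ-loc-Q)[mGs₀] (the letters alone, `∃ c`); conclusion κ-BLOCK-TF[mGs₀] VERBATIM (the organ may re-pick `c`)
          ∀ (γ₀ : (UnitaryGroup.cmDatum L 3 H').Rational) (e₁ e₂ : L), e₁ ≠ e₂ →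
            ((((γ₀ : unitaryGroup (cmConjRingHom L) H').val : GL (Fin 3) L) : Matrix (Fin 3) (Fin 3) L) - e₁ • (1 : Matrix (Fin 3) (Fin 3) L)) * ((((γ₀ : unitaryGroup (cmConjRingHom L) H').val : GL (Fin 3) L) : Matrix (Fin 3) (Fin 3) L) - e₂ • (1 : Matrix (Fin 3) (Fin 3) L)) = 0 →
            (¬ ∃ ζ : L, (((γ₀ : unitaryGroup (cmConjRingHom L) H').val : GL (Fin 3) L) : Matrix (Fin 3) (Fin 3) L) = ζ • (1 : Matrix (Fin 3) (Fin 3) L)) →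
            (((γ₀ : unitaryGroup (cmConjRingHom L) H').val : GL (Fin 3) L) : Matrix (Fin 3) (Fin 3) L).charpoly =
              (Polynomial.X - Polynomial.C e₁) ^ 2 * (Polynomial.X - Polynomial.C e₂) →
            ∀ (γH : (UnitaryGroup.cmDatum L 2 (Matrix.of fun i j : Fin 2 => if i.val + j.val + 1 = 2 then (1 : L) else 0)).Rational ×
                (UnitaryGroup.cmDatum L 1 (Matrix.of fun i j : Fin 1 => if i.val + j.val + 1 = 1 then (1 : L) else 0)).Rational),
              (((γH.1 : unitaryGroup (cmConjRingHom L) (Matrix.of fun i j : Fin 2 => if i.val + j.val + 1 = 2 then (1 : L) else 0)).val : GL (Fin 2) L) : Matrix (Fin 2) (Fin 2) L) =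
                e₁ • (1 : Matrix (Fin 2) (Fin 2) L) →
              (((γH.2 : unitaryGroup (cmConjRingHom L) (Matrix.of fun i j : Fin 1 => if i.val + j.val + 1 = 1 then (1 : L) else 0)).val : GL (Fin 1) L) : Matrix (Fin 1) (Fin 1) L) 0 0 = e₂ →
              (∃ (c : HeightOneSpectrum (𝓞 ↥(maximalRealSubfield L)) → ℂ), (∀ v, c v ≠ 0) ∧
                (∀ (v : HeightOneSpectrum (𝓞 ↥(maximalRealSubfield L)))
                      (fH : (UnitaryGroup.cmDatum L 2 (Matrix.of fun i j : Fin 2 => if i.val + j.val + 1 = 2 then (1 : L) else 0)).Local v × (UnitaryGroup.cmDatum L 1 (Matrix.of fun i j : Fin 1 => if i.val + j.val + 1 = 1 then (1 : L) else 0)).Local v → ℂ) (f : (UnitaryGroup.cmDatum L 3 H').Local v → ℂ),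
                    IsLocSmooth f → IsLocSmooth fH → IsLocalDeltaTransfer L H' v (Δ v) (mH v) (mG v) fH f →
                    localStableOrbitalIntegral L 3 H' v (mGs₀ v) f ((UnitaryGroup.cmDatum L 3 H').toLocal v ((UnitaryGroup.cmDatum L 3 H').toAdelic γ₀)) =
                      c v * fH ((UnitaryGroup.cmDatum L 2 (Matrix.of fun i j : Fin 2 => if i.val + j.val + 1 = 2 then (1 : L) else 0)).toLocal v ((UnitaryGroup.cmDatum L 2 (Matrix.of fun i j : Fin 2 => if i.val + j.val + 1 = 2 then (1 : L) else 0)).toAdelic γH.1),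
                        (UnitaryGroup.cmDatum L 1 (Matrix.of fun i j : Fin 1 => if i.val + j.val + 1 = 1 then (1 : L) else 0)).toLocal v ((UnitaryGroup.cmDatum L 1 (Matrix.of fun i j : Fin 1 => if i.val + j.val + 1 = 1 then (1 : L) else 0)).toAdelic γH.2)))) →
              ∃ (c : HeightOneSpectrum (𝓞 ↥(maximalRealSubfield L)) → ℂ) (cinf : ℂ), (∀ v, c v ≠ 0) ∧ cinf ≠ 0 ∧
                (∀ (v : HeightOneSpectrum (𝓞 ↥(maximalRealSubfield L)))
                      (fH : (UnitaryGroup.cmDatum L 2 (Matrix.of fun i j : Fin 2 => if i.val + j.val + 1 = 2 then (1 : L) else 0)).Local v × (UnitaryGroup.cmDatum L 1 (Matrix.of fun i j : Fin 1 => if i.val + j.val + 1 = 1 then (1 : L) else 0)).Local v → ℂ) (f : (UnitaryGroup.cmDatum L 3 H').Local v → ℂ),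
                    IsLocSmooth f → IsLocSmooth fH → IsLocalDeltaTransfer L H' v (Δ v) (mH v) (mG v) fH f →
                    localStableOrbitalIntegral L 3 H' v (mGs₀ v) f ((UnitaryGroup.cmDatum L 3 H').toLocal v ((UnitaryGroup.cmDatum L 3 H').toAdelic γ₀)) =
                      c v * fH ((UnitaryGroup.cmDatum L 2 (Matrix.of fun i j : Fin 2 => if i.val + j.val + 1 = 2 then (1 : L) else 0)).toLocal v ((UnitaryGroup.cmDatum L 2 (Matrix.of fun i j : Fin 2 => if i.val + j.val + 1 = 2 then (1 : L) else 0)).toAdelic γH.1),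
                        (UnitaryGroup.cmDatum L 1 (Matrix.of fun i j : Fin 1 => if i.val + j.val + 1 = 1 then (1 : L) else 0)).toLocal v ((UnitaryGroup.cmDatum L 1 (Matrix.of fun i j : Fin 1 => if i.val + j.val + 1 = 1 then (1 : L) else 0)).toAdelic γH.2))) ∧
                (∀ (aH : UnitaryGroup.arch (↥(maximalRealSubfield L)) L (IsCMField.complexConj L) 2 (Matrix.of fun i j : Fin 2 => if i.val + j.val + 1 = 2 then (1 : L) else 0) ×
                        UnitaryGroup.arch (↥(maximalRealSubfield L)) L (IsCMField.complexConj L) 1 (Matrix.of fun i j : Fin 1 => if i.val + j.val + 1 = 1 then (1 : L) else 0) → ℂ)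
                      (a : UnitaryGroup.arch (↥(maximalRealSubfield L)) L (IsCMField.complexConj L) 3 H' → ℂ),
                    ArchSmooth L 3 H' a → ArchSmooth₂ L aH → IsArchDeltaTransfer L H' Tinf mHi m' aH a →
                    archStableOrbitalIntegral L 3 H' (Literature.NumberTheory.Weil1964.UnitaryArchTopForm.archSingularTopFormFamily L H' νGi) a (cmRationalToArch L 3 H' γ₀) =
                      cinf * aH (cmRationalToArch L 2 (Matrix.of fun i j : Fin 2 => if i.val + j.val + 1 = 2 then (1 : L) else 0) γH.1, cmRationalToArch L 1 (Matrix.of fun i j : Fin 1 => if i.val + j.val + 1 = 1 then (1 : L) else 0) γH.2)) ∧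
                (∀ S_c : Finset (HeightOneSpectrum (𝓞 ↥(maximalRealSubfield L))), (∀ v ∉ S_c, c v = 1) →
                    ∃ r : ℝ, 0 < r ∧ cinf * ∏ v ∈ S_c, c v = (r : ℂ)))
    :
    ∀ (hK : ∀ v : HeightOneSpectrum (𝓞 ↥(maximalRealSubfield L)), νG v (UnitaryGroup.cmLocalIntegralLevel L 3 H' v : Set ((UnitaryGroup.cmDatum L 3 H').Local v)) = 1)
  (hanis : ∀ x : Fin 3 → L, hermForm (cmConjRingHom L) H' x x = 0 → x = 0)
  (Sbad : Finset (HeightOneSpectrum (𝓞 ↥(maximalRealSubfield L))))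
      (Δ : ∀ v : HeightOneSpectrum (𝓞 ↥(maximalRealSubfield L)), LocalTransferFactor L H' v)
      (mH : ∀ v : HeightOneSpectrum (𝓞 ↥(maximalRealSubfield L)),
        OrbitalMeasureFamily ((UnitaryGroup.cmDatum L 2 (Matrix.of fun i j : Fin 2 => if i.val + j.val + 1 = 2 then (1 : L) else 0)).Local v ×
          (UnitaryGroup.cmDatum L 1 (Matrix.of fun i j : Fin 1 => if i.val + j.val + 1 = 1 then (1 : L) else 0)).Local v))
      (mG : ∀ v : HeightOneSpectrum (𝓞 ↥(maximalRealSubfield L)), OrbitalMeasureFamily ((UnitaryGroup.cmDatum L 3 H').Local v))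
  (m' : OrbitalMeasureFamily (UnitaryGroup.arch (↥(maximalRealSubfield L)) L (IsCMField.complexConj L) 3 H'))
        (m : OrbitalMeasureFamily (UnitaryGroup.arch (↥(maximalRealSubfield L)) L (IsCMField.complexConj L) 3
          (Matrix.of fun i j : Fin 3 => if i.val + j.val + 1 = 3 then (1 : L) else 0)))
        (mHi : OrbitalMeasureFamily (UnitaryGroup.arch (↥(maximalRealSubfield L)) L (IsCMField.complexConj L) 2
            (Matrix.of fun i j : Fin 2 => if i.val + j.val + 1 = 2 then (1 : L) else 0) ×
          UnitaryGroup.arch (↥(maximalRealSubfield L)) L (IsCMField.complexConj L) 1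
            (Matrix.of fun i j : Fin 1 => if i.val + j.val + 1 = 1 then (1 : L) else 0)))
        (t' : ∀ γ' : UnitaryGroup.arch (↥(maximalRealSubfield L)) L (IsCMField.complexConj L) 3 H',
          Measure (Subgroup.centralizer ({γ'} : Set (UnitaryGroup.arch (↥(maximalRealSubfield L)) L (IsCMField.complexConj L) 3 H'))))
        (t : ∀ γ : UnitaryGroup.arch (↥(maximalRealSubfield L)) L (IsCMField.complexConj L) 3
            (Matrix.of fun i j : Fin 3 => if i.val + j.val + 1 = 3 then (1 : L) else 0),
          Measure (Subgroup.centralizer ({γ} : Set (UnitaryGroup.arch (↥(maximalRealSubfield L)) L (IsCMField.complexConj L) 3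
            (Matrix.of fun i j : Fin 3 => if i.val + j.val + 1 = 3 then (1 : L) else 0)))))
        (tH : ∀ γH : UnitaryGroup.arch (↥(maximalRealSubfield L)) L (IsCMField.complexConj L) 2
              (Matrix.of fun i j : Fin 2 => if i.val + j.val + 1 = 2 then (1 : L) else 0) ×
            UnitaryGroup.arch (↥(maximalRealSubfield L)) L (IsCMField.complexConj L) 1
              (Matrix.of fun i j : Fin 1 => if i.val + j.val + 1 = 1 then (1 : L) else 0),
          Measure (Subgroup.centralizer ({γH} : Set (UnitaryGroup.arch (↥(maximalRealSubfield L)) L (IsCMField.complexConj L) 2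
              (Matrix.of fun i j : Fin 2 => if i.val + j.val + 1 = 2 then (1 : L) else 0) ×
            UnitaryGroup.arch (↥(maximalRealSubfield L)) L (IsCMField.complexConj L) 1
              (Matrix.of fun i j : Fin 1 => if i.val + j.val + 1 = 1 then (1 : L) else 0)))))
    (hherm : (H'.map (cmConjRingHom L)).transpose = H')
    (hCTM : CanonicalTransferMatrix L H' Tinf.Δ νH νG Sbad Δ mH mG)
    (hACS : ArchCanonicalSingularMatrix L H' Tinf νGi νqi νHi hanis m' m mHi t' t tH),
    ∃ (tGs : ∀ (v : HeightOneSpectrum (𝓞 ↥(maximalRealSubfield L))) (γ : (UnitaryGroup.cmDatum L 3 H').Local v), Measure ↥(Subgroup.centralizer ({γ} : Set ((UnitaryGroup.cmDatum L 3 H').Local v)))),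
      -- (HAAR) = ★ p847860's (X1): inversion-invariant Haar partners at the guarded local points
      (∀ (v : HeightOneSpectrum (𝓞 ↥(maximalRealSubfield L))) (x : (UnitaryGroup.cmDatum L 3 H').Local v),
        (∃ γ₀ : (UnitaryGroup.cmDatum L 3 H').Rational, ¬ IsRegularElt (γ₀.val : GL (Fin 3) L) ∧
            Corresponds (UnitaryGroup.conjLocal L (IsCMField.complexConj L) v)
              ((UnitaryGroup.adelicForm L 3 H').map (UnitaryGroup.adeleToLocal L v))
              ((UnitaryGroup.adelicForm L 3 H').map (UnitaryGroup.adeleToLocal L v))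
              ((UnitaryGroup.cmDatum L 3 H').toLocal v ((UnitaryGroup.cmDatum L 3 H').toAdelic γ₀)) x) →
        (tGs v x).IsHaarMeasure ∧ (tGs v x).IsInvInvariant) ∧
      -- (COH-fin) VERBATIM (= ★ p847860's `hcoh`)
      (∀ (v : HeightOneSpectrum (𝓞 ↥(maximalRealSubfield L))) (γ₁ γ₂ q : (UnitaryGroup.cmDatum L 3 H').Local v) (hq : (MulAut.conj q : (UnitaryGroup.cmDatum L 3 H').Local v ≃* (UnitaryGroup.cmDatum L 3 H').Local v) γ₁ = γ₂),
        (∃ γ₀ : (UnitaryGroup.cmDatum L 3 H').Rational, ¬ IsRegularElt (γ₀.val : GL (Fin 3) L) ∧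
            Corresponds (UnitaryGroup.conjLocal L (IsCMField.complexConj L) v)
              ((UnitaryGroup.adelicForm L 3 H').map (UnitaryGroup.adeleToLocal L v))
              ((UnitaryGroup.adelicForm L 3 H').map (UnitaryGroup.adeleToLocal L v))
              ((UnitaryGroup.cmDatum L 3 H').toLocal v ((UnitaryGroup.cmDatum L 3 H').toAdelic γ₀)) γ₁) →
        Measure.map (subgroupCongrHomeomorph (MulAut.conj q : (UnitaryGroup.cmDatum L 3 H').Local v ≃* (UnitaryGroup.cmDatum L 3 H').Local v) (Subgroup.centralizer ({γ₁} : Set ((UnitaryGroup.cmDatum L 3 H').Local v)))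
          (Subgroup.centralizer ({γ₂} : Set ((UnitaryGroup.cmDatum L 3 H').Local v))) (forall_apply_mem_centralizer_singleton_iff_of_eq (MulAut.conj q : (UnitaryGroup.cmDatum L 3 H').Local v ≃* (UnitaryGroup.cmDatum L 3 H').Local v) hq)
          (continuous_mulAutConj q) (continuous_mulAutConj_symm q)) (tGs v γ₁) = tGs v γ₂) ∧
      -- (LEV) = ★ p847860's `hlev`: level mass one at every non-regular rational point at cofinitely many places [§1.7 p. 6, p. 11; §4.3 p. 44]
      (∀ γ₀ : (UnitaryGroup.cmDatum L 3 H').Rational, ¬ IsRegularElt (γ₀.val : GL (Fin 3) L) →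
        ∀ᶠ v : HeightOneSpectrum (𝓞 ↥(maximalRealSubfield L)) in Filter.cofinite,
          tGs v ((UnitaryGroup.cmDatum L 3 H').toLocal v ((UnitaryGroup.cmDatum L 3 H').toAdelic γ₀))
            (Subtype.val ⁻¹' (UnitaryGroup.cmLocalIntegralLevel L 3 H' v : Set ((UnitaryGroup.cmDatum L 3 H').Local v))) = 1) ∧
      -- (CEN) = ★ p847860's `hcen`: level mass one at the rational scalars at EVERY place [Prop. 10.1.2 (b)]
      (∀ (γ₀ : (UnitaryGroup.cmDatum L 3 H').Rational) (ζ : L), (((γ₀.val : GL (Fin 3) L)) : Matrix (Fin 3) (Fin 3) L) = ζ • (1 : Matrix (Fin 3) (Fin 3) L) →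
        ∀ v : HeightOneSpectrum (𝓞 ↥(maximalRealSubfield L)),
          tGs v ((UnitaryGroup.cmDatum L 3 H').toLocal v ((UnitaryGroup.cmDatum L 3 H').toAdelic γ₀))
            (Subtype.val ⁻¹' (UnitaryGroup.cmLocalIntegralLevel L 3 H' v : Set ((UnitaryGroup.cmDatum L 3 H').Local v))) = 1) ∧
      -- (κ-Q₀) ONE Weil-quotient family `mGs₀` of `νG_v` by `tGs v` ((Q-fin) VERBATIM with `mGs₀`) carrying the κ-BLOCK-TF VERBATIM (with `mGs₀`)
      ∃ (mGs₀ : ∀ v : HeightOneSpectrum (𝓞 ↥(maximalRealSubfield L)), OrbitalMeasureFamily ((UnitaryGroup.cmDatum L 3 H').Local v)),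
        (∀ v, (mGs₀ v).IsQuotientOf (fun x : (UnitaryGroup.cmDatum L 3 H').Local v => ∃ γ₀ : (UnitaryGroup.cmDatum L 3 H').Rational, ¬ IsRegularElt (γ₀.val : GL (Fin 3) L) ∧
            Corresponds (UnitaryGroup.conjLocal L (IsCMField.complexConj L) v)
              ((UnitaryGroup.adelicForm L 3 H').map (UnitaryGroup.adeleToLocal L v))
              ((UnitaryGroup.adelicForm L 3 H').map (UnitaryGroup.adeleToLocal L v))
              ((UnitaryGroup.cmDatum L 3 H').toLocal v ((UnitaryGroup.cmDatum L 3 H').toAdelic γ₀)) x) (νG v) (tGs v)) ∧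
        (∀ (γ₀ : (UnitaryGroup.cmDatum L 3 H').Rational) (e₁ e₂ : L), e₁ ≠ e₂ →
        ((((γ₀ : unitaryGroup (cmConjRingHom L) H').val : GL (Fin 3) L) : Matrix (Fin 3) (Fin 3) L) - e₁ • (1 : Matrix (Fin 3) (Fin 3) L)) * ((((γ₀ : unitaryGroup (cmConjRingHom L) H').val : GL (Fin 3) L) : Matrix (Fin 3) (Fin 3) L) - e₂ • (1 : Matrix (Fin 3) (Fin 3) L)) = 0 →
        (¬ ∃ ζ : L, (((γ₀ : unitaryGroup (cmConjRingHom L) H').val : GL (Fin 3) L) : Matrix (Fin 3) (Fin 3) L) = ζ • (1 : Matrix (Fin 3) (Fin 3) L)) →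
        (((γ₀ : unitaryGroup (cmConjRingHom L) H').val : GL (Fin 3) L) : Matrix (Fin 3) (Fin 3) L).charpoly =
          (Polynomial.X - Polynomial.C e₁) ^ 2 * (Polynomial.X - Polynomial.C e₂) →
        ∀ (γH : (UnitaryGroup.cmDatum L 2 (Matrix.of fun i j : Fin 2 => if i.val + j.val + 1 = 2 then (1 : L) else 0)).Rational ×
            (UnitaryGroup.cmDatum L 1 (Matrix.of fun i j : Fin 1 => if i.val + j.val + 1 = 1 then (1 : L) else 0)).Rational),
          (((γH.1 : unitaryGroup (cmConjRingHom L) (Matrix.of fun i j : Fin 2 => if i.val + j.val + 1 = 2 then (1 : L) else 0)).val : GL (Fin 2) L) : Matrix (Fin 2) (Fin 2) L) =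
            e₁ • (1 : Matrix (Fin 2) (Fin 2) L) →
          (((γH.2 : unitaryGroup (cmConjRingHom L) (Matrix.of fun i j : Fin 1 => if i.val + j.val + 1 = 1 then (1 : L) else 0)).val : GL (Fin 1) L) : Matrix (Fin 1) (Fin 1) L) 0 0 = e₂ →
          ∃ (c : HeightOneSpectrum (𝓞 ↥(maximalRealSubfield L)) → ℂ) (cinf : ℂ), (∀ v, c v ≠ 0) ∧ cinf ≠ 0 ∧
            (∀ (v : HeightOneSpectrum (𝓞 ↥(maximalRealSubfield L)))
                  (fH : (UnitaryGroup.cmDatum L 2 (Matrix.of fun i j : Fin 2 => if i.val + j.val + 1 = 2 then (1 : L) else 0)).Local v × (UnitaryGroup.cmDatum L 1 (Matrix.of fun i j : Fin 1 => if i.val + j.val + 1 = 1 then (1 : L) else 0)).Local v → ℂ) (f : (UnitaryGroup.cmDatum L 3 H').Local v → ℂ),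
                IsLocSmooth f → IsLocSmooth fH → IsLocalDeltaTransfer L H' v (Δ v) (mH v) (mG v) fH f →
                localStableOrbitalIntegral L 3 H' v (mGs₀ v) f ((UnitaryGroup.cmDatum L 3 H').toLocal v ((UnitaryGroup.cmDatum L 3 H').toAdelic γ₀)) =
                  c v * fH ((UnitaryGroup.cmDatum L 2 (Matrix.of fun i j : Fin 2 => if i.val + j.val + 1 = 2 then (1 : L) else 0)).toLocal v ((UnitaryGroup.cmDatum L 2 (Matrix.of fun i j : Fin 2 => if i.val + j.val + 1 = 2 then (1 : L) else 0)).toAdelic γH.1),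
                    (UnitaryGroup.cmDatum L 1 (Matrix.of fun i j : Fin 1 => if i.val + j.val + 1 = 1 then (1 : L) else 0)).toLocal v ((UnitaryGroup.cmDatum L 1 (Matrix.of fun i j : Fin 1 => if i.val + j.val + 1 = 1 then (1 : L) else 0)).toAdelic γH.2))) ∧
            (∀ (aH : UnitaryGroup.arch (↥(maximalRealSubfield L)) L (IsCMField.complexConj L) 2 (Matrix.of fun i j : Fin 2 => if i.val + j.val + 1 = 2 then (1 : L) else 0) ×
                    UnitaryGroup.arch (↥(maximalRealSubfield L)) L (IsCMField.complexConj L) 1 (Matrix.of fun i j : Fin 1 => if i.val + j.val + 1 = 1 then (1 : L) else 0) → ℂ)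
                  (a : UnitaryGroup.arch (↥(maximalRealSubfield L)) L (IsCMField.complexConj L) 3 H' → ℂ),
                ArchSmooth L 3 H' a → ArchSmooth₂ L aH → IsArchDeltaTransfer L H' Tinf mHi m' aH a →
                archStableOrbitalIntegral L 3 H' (Literature.NumberTheory.Weil1964.UnitaryArchTopForm.archSingularTopFormFamily L H' νGi) a (cmRationalToArch L 3 H' γ₀) =
                  cinf * aH (cmRationalToArch L 2 (Matrix.of fun i j : Fin 2 => if i.val + j.val + 1 = 2 then (1 : L) else 0) γH.1, cmRationalToArch L 1 (Matrix.of fun i j : Fin 1 => if i.val + j.val + 1 = 1 then (1 : L) else 0) γH.2)) ∧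
            (∀ S_c : Finset (HeightOneSpectrum (𝓞 ↥(maximalRealSubfield L))), (∀ v ∉ S_c, c v = 1) →
                ∃ r : ℝ, 0 < r ∧ cinf * ∏ v ∈ S_c, c v = (r : ℂ))) := by
  intro hK hanis Sbad Δ mH mG m' m mHi t' t tH hherm hCTM hACS
  obtain ⟨mGs₀, tGs₀, hQ₀, hcoh₀, hlev₀, hκ₀, -⟩ := href hK hanis Sbad Δ mH mG m' m mHi t' t tH hherm hCTM hACS
  classical
  -- (HAAR)₀: print's partners are Haar and inversion invariant at EVERY guard point ((Q-fin)₀ at the representative, (COH-fin)₀ along the conjugation; ★ p848504)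
  have hHaar₀ : ∀ (v : HeightOneSpectrum (𝓞 ↥(maximalRealSubfield L))) (x : (UnitaryGroup.cmDatum L 3 H').Local v),
      (∃ γ₀ : (UnitaryGroup.cmDatum L 3 H').Rational, ¬ IsRegularElt (γ₀.val : GL (Fin 3) L) ∧
          Corresponds (UnitaryGroup.conjLocal L (IsCMField.complexConj L) v)
            ((UnitaryGroup.adelicForm L 3 H').map (UnitaryGroup.adeleToLocal L v))
            ((UnitaryGroup.adelicForm L 3 H').map (UnitaryGroup.adeleToLocal L v))
            ((UnitaryGroup.cmDatum L 3 H').toLocal v ((UnitaryGroup.cmDatum L 3 H').toAdelic γ₀)) x) →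
      (tGs₀ v x).IsHaarMeasure ∧ (tGs₀ v x).IsInvInvariant := fun v x hx =>
    isHaarMeasure_and_isInvInvariant_partner L H' νG v (mGs₀ v) (tGs₀ v) (hQ₀ v) (hcoh₀ v) x hx
  -- THE RESCALING FACTOR `a v x`: the inverse level mass at the local images of the rational scalars, `1` elsewhere
  obtain ⟨a, ha1, haP⟩ : ∃ a : ∀ v : HeightOneSpectrum (𝓞 ↥(maximalRealSubfield L)), (UnitaryGroup.cmDatum L 3 H').Local v → ℝ≥0,
      (∀ (v : HeightOneSpectrum (𝓞 ↥(maximalRealSubfield L))) (x : (UnitaryGroup.cmDatum L 3 H').Local v),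
        (¬ ∃ (γ₁ : (UnitaryGroup.cmDatum L 3 H').Rational) (ζ : L), (((γ₁.val : GL (Fin 3) L)) : Matrix (Fin 3) (Fin 3) L) = ζ • (1 : Matrix (Fin 3) (Fin 3) L) ∧
            x = (UnitaryGroup.cmDatum L 3 H').toLocal v ((UnitaryGroup.cmDatum L 3 H').toAdelic γ₁)) → a v x = 1) ∧
      (∀ (v : HeightOneSpectrum (𝓞 ↥(maximalRealSubfield L))) (x : (UnitaryGroup.cmDatum L 3 H').Local v),
        (∃ (γ₁ : (UnitaryGroup.cmDatum L 3 H').Rational) (ζ : L), (((γ₁.val : GL (Fin 3) L)) : Matrix (Fin 3) (Fin 3) L) = ζ • (1 : Matrix (Fin 3) (Fin 3) L) ∧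
            x = (UnitaryGroup.cmDatum L 3 H').toLocal v ((UnitaryGroup.cmDatum L 3 H').toAdelic γ₁)) →
          (a v x : ℝ≥0∞) * tGs₀ v x (Subtype.val ⁻¹' (UnitaryGroup.cmLocalIntegralLevel L 3 H' v : Set ((UnitaryGroup.cmDatum L 3 H').Local v))) = 1) := by
    refine ⟨fun v x => if (∃ (γ₁ : (UnitaryGroup.cmDatum L 3 H').Rational) (ζ : L), (((γ₁.val : GL (Fin 3) L)) : Matrix (Fin 3) (Fin 3) L) = ζ • (1 : Matrix (Fin 3) (Fin 3) L) ∧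
            x = (UnitaryGroup.cmDatum L 3 H').toLocal v ((UnitaryGroup.cmDatum L 3 H').toAdelic γ₁)) then
          ((tGs₀ v x (Subtype.val ⁻¹' (UnitaryGroup.cmLocalIntegralLevel L 3 H' v : Set ((UnitaryGroup.cmDatum L 3 H').Local v)))).toNNReal)⁻¹ else 1,
      fun v x hx => if_neg hx, fun v x hx => ?_⟩
    obtain ⟨γ₁, ζ, hζ, rfl⟩ := hx
    -- `(ζ•1)_v` is a guard point (a rational scalar is non-regular; `↔` is reflexive), so `tGs₀ v (ζ•1)_v` is a Haar measure: `0 < mass(Z ∩ K_v) < ∞`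
    obtain ⟨hH, -⟩ := hHaar₀ v _ (not_isRegularElt_and_corresponds_self L H' v γ₁ (not_isRegularElt_of_coe_eq_smul_one γ₁ hζ))
    haveI := hH
    obtain ⟨h0, htop⟩ := measure_preimage_level_pos_lt_top L H' v _ (tGs₀ v ((UnitaryGroup.cmDatum L 3 H').toLocal v ((UnitaryGroup.cmDatum L 3 H').toAdelic γ₁)))
    have hne : (tGs₀ v ((UnitaryGroup.cmDatum L 3 H').toLocal v ((UnitaryGroup.cmDatum L 3 H').toAdelic γ₁))
        (Subtype.val ⁻¹' (UnitaryGroup.cmLocalIntegralLevel L 3 H' v : Set ((UnitaryGroup.cmDatum L 3 H').Local v)))).toNNReal ≠ 0 := by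
      rw [Ne, ENNReal.toNNReal_eq_zero_iff, not_or]
      exact ⟨h0.ne', htop.ne⟩
    beta_reduce
    rw [if_pos ⟨γ₁, ζ, hζ, rfl⟩, ENNReal.coe_inv hne, ENNReal.coe_toNNReal htop.ne, ENNReal.inv_mul_cancel h0.ne' htop.ne]
  -- `a v x ≠ 0` everywhere
  have ha0 : ∀ (v : HeightOneSpectrum (𝓞 ↥(maximalRealSubfield L))) (x : (UnitaryGroup.cmDatum L 3 H').Local v), a v x ≠ 0 := by
    intro v x h0
    by_cases hx : ∃ (γ₁ : (UnitaryGroup.cmDatum L 3 H').Rational) (ζ : L), (((γ₁.val : GL (Fin 3) L)) : Matrix (Fin 3) (Fin 3) L) = ζ • (1 : Matrix (Fin 3) (Fin 3) L) ∧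
        x = (UnitaryGroup.cmDatum L 3 H').toLocal v ((UnitaryGroup.cmDatum L 3 H').toAdelic γ₁)
    · have h1 := haP v x hx
      rw [h0, ENNReal.coe_zero, zero_mul] at h1
      exact zero_ne_one h1
    · exact one_ne_zero ((ha1 v x hx).symm.trans h0)
  -- THE REPAIRED SYSTEM: partners `a v x • tGs₀ v x`, members `(a v (out c))⁻¹ • mGs₀ v c` (Weil's rule `dν ∕ d(a·t) = a⁻¹ · dν ∕ dt`)
  refine ⟨fun v x => a v x • tGs₀ v x, ?_, ?_, ?_, ?_, fun v cl => (a v (Quotient.out cl))⁻¹ • mGs₀ v cl, ?_, ?_⟩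
  · -- (HAAR): positive multiples of Haar ∕ inversion-invariant measures
    intro v x hx
    obtain ⟨hH, hI⟩ := hHaar₀ v x hx
    haveI := hH
    haveI := hI
    exact ⟨IsHaarMeasure.nnreal_smul _ (ha0 v x), isInvInvariant_nnreal_smul _ _⟩
  · -- (COH-fin): a rational-scalar image is central (its conjugates are itself, and the predicate is conjugation-stable); elsewhere (COH-fin)₀
    intro v γ₁ γ₂ q hq hγ₁
    dsimp only
    by_cases hP : ∃ (γ₃ : (UnitaryGroup.cmDatum L 3 H').Rational) (ζ : L), (((γ₃.val : GL (Fin 3) L)) : Matrix (Fin 3) (Fin 3) L) = ζ • (1 : Matrix (Fin 3) (Fin 3) L) ∧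
        γ₁ = (UnitaryGroup.cmDatum L 3 H').toLocal v ((UnitaryGroup.cmDatum L 3 H').toAdelic γ₃)
    · obtain ⟨γ₃, ζ, hζ, rfl⟩ := hP
      have he : γ₂ = (UnitaryGroup.cmDatum L 3 H').toLocal v ((UnitaryGroup.cmDatum L 3 H').toAdelic γ₃) := by
        rw [← hq, MulAut.conj_apply]
        exact conj_toLocal_eq_of_coe_eq_smul_one L H' v γ₃ hζ q
      subst he
      rw [Measure.map_smul, hcoh₀ v _ _ q hq hγ₁]
    · have hP₂ : ¬ ∃ (γ₃ : (UnitaryGroup.cmDatum L 3 H').Rational) (ζ : L), (((γ₃.val : GL (Fin 3) L)) : Matrix (Fin 3) (Fin 3) L) = ζ • (1 : Matrix (Fin 3) (Fin 3) L) ∧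
          γ₂ = (UnitaryGroup.cmDatum L 3 H').toLocal v ((UnitaryGroup.cmDatum L 3 H').toAdelic γ₃) := by
        rintro ⟨γ₃, ζ, hζ, h₂⟩
        refine hP ⟨γ₃, ζ, hζ, eq_toLocal_of_conj_eq_toLocal_of_coe_eq_smul_one L H' v γ₃ hζ γ₁ q ?_⟩
        rw [← h₂, ← hq, MulAut.conj_apply]
      rw [ha1 v γ₁ hP, ha1 v γ₂ hP₂, one_smul, one_smul]
      exact hcoh₀ v γ₁ γ₂ q hq hγ₁
  · -- (LEV): wherever (LEV)₀ gives level mass one, `a v = 1`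
    intro γ₀ hγ₀
    filter_upwards [hlev₀ γ₀ hγ₀] with v hv
    rw [Measure.smul_apply, ENNReal.smul_def, smul_eq_mul]
    by_cases hP : ∃ (γ₁ : (UnitaryGroup.cmDatum L 3 H').Rational) (ζ : L), (((γ₁.val : GL (Fin 3) L)) : Matrix (Fin 3) (Fin 3) L) = ζ • (1 : Matrix (Fin 3) (Fin 3) L) ∧
        (UnitaryGroup.cmDatum L 3 H').toLocal v ((UnitaryGroup.cmDatum L 3 H').toAdelic γ₀) = (UnitaryGroup.cmDatum L 3 H').toLocal v ((UnitaryGroup.cmDatum L 3 H').toAdelic γ₁)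
    · exact haP v _ hP
    · rw [ha1 v _ hP, hv, ENNReal.coe_one, one_mul]
  · -- (CEN): the inverse level mass times the level mass
    intro γ₀ ζ hζ v
    rw [Measure.smul_apply, ENNReal.smul_def, smul_eq_mul]
    exact haP v _ ⟨γ₀, ζ, hζ, rfl⟩
  · -- (Q-fin) for the repaired system: Weil's rule `dν ∕ d(a·t) = a⁻¹ · dν ∕ dt` (★ `quotientMeasure_eq_inv_smul_of_eq_smul`)
    intro v cl hcl
    obtain ⟨hH, hI, hq⟩ := (OrbitalMeasureFamily.isQuotientOf_iff _ _ _ _).1 (hQ₀ v) cl hcl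
    haveI := hH
    haveI := hI
    haveI hH' : (a v (Quotient.out cl) • tGs₀ v (Quotient.out cl)).IsHaarMeasure := IsHaarMeasure.nnreal_smul _ (ha0 v _)
    haveI hI' : (a v (Quotient.out cl) • tGs₀ v (Quotient.out cl)).IsInvInvariant := isInvInvariant_nnreal_smul _ _
    refine ⟨hH', hI', ?_⟩
    dsimp only
    rw [hq]
    haveI : IsClosed ((Subgroup.centralizer ({(Quotient.out cl : (UnitaryGroup.cmDatum L 3 H').Local v)} : Set ((UnitaryGroup.cmDatum L 3 H').Local v)) :
        Subgroup ((UnitaryGroup.cmDatum L 3 H').Local v)) : Set ((UnitaryGroup.cmDatum L 3 H').Local v)) := isClosed_coe_centralizer_singleton _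
    exact (quotientMeasure_eq_inv_smul_of_eq_smul _ (νG v) (tGs₀ v (Quotient.out cl)) (a v (Quotient.out cl) • tGs₀ v (Quotient.out cl))
      (a v (Quotient.out cl)) (ha0 v _) rfl).symm
  · -- κ-BLOCK-TF: ARCH-κ-SIGN∀ on print's system `(mGs₀, tGs₀)` fed with (κ-loc-Q)₀, then transport of (κ-loc) to the repaired members class by class
    intro γ₀ e₁ e₂ hne hmul hnc hchar γH hγH1 hγH2
    obtain ⟨c, cinf, hc, hcinf, hloc, harch, hsign⟩ :=
      hAKS hK hanis Sbad Δ mH mG m' m mHi t' t tH hherm hCTM hACS mGs₀ tGs₀ hQ₀ hcoh₀ hlev₀ γ₀ e₁ e₂ hne hmul hnc hchar γH hγH1 hγH2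
        (hκ₀ γ₀ e₁ e₂ hne hmul hnc hchar γH hγH1 hγH2)
    refine ⟨c, cinf, hc, hcinf, fun v fH f hf hfH htr => ?_, harch, hsign⟩
    -- the letters read the members only on the classes `↔ (γ₀)_v`; none of them is a rational-scalar image (else `γ₀ = ζ•1`), so `a = 1` there
    have key : localStableOrbitalIntegral L 3 H' v (fun cl => (a v (Quotient.out cl))⁻¹ • mGs₀ v cl) f
          ((UnitaryGroup.cmDatum L 3 H').toLocal v ((UnitaryGroup.cmDatum L 3 H').toAdelic γ₀)) =
        localStableOrbitalIntegral L 3 H' v (mGs₀ v) f ((UnitaryGroup.cmDatum L 3 H').toLocal v ((UnitaryGroup.cmDatum L 3 H').toAdelic γ₀)) := by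
      refine stableOrbitalIntegralRel_congr_measure _ (fun cl hcl => ?_) f
      have hnP : ¬ ∃ (γ₁ : (UnitaryGroup.cmDatum L 3 H').Rational) (ζ : L), (((γ₁.val : GL (Fin 3) L)) : Matrix (Fin 3) (Fin 3) L) = ζ • (1 : Matrix (Fin 3) (Fin 3) L) ∧
          Quotient.out cl = (UnitaryGroup.cmDatum L 3 H').toLocal v ((UnitaryGroup.cmDatum L 3 H').toAdelic γ₁) := by
        rintro ⟨γ₁, ζ, hζ, hcl₁⟩
        exact hnc ⟨ζ, coe_eq_smul_one_of_isStablyConj_toLocal_of_coe_eq_smul_one L H' v γ₀ γ₁ hζ hcl hcl₁⟩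
      show (a v (Quotient.out cl))⁻¹ • mGs₀ v cl = mGs₀ v cl
      rw [ha1 v _ hnP, inv_one, one_smul]
    exact key.trans (hloc v fH f hf hfH htr)

end Frame

end Literature.NumberTheory.Rogawski1990

end
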